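/-
Planner work file (lens «barrier inversion» at crux level, generation 18) for the crux
`KrwChromaticSteering.StrongComposition` (C1, stmt-PneNP-18538), route `route-PneNP-KrwChromaticSteering`.
Seat pnp-ideate-p4 (g18), 2026-08-29.  Sorry-free.  Published with
`ledger crux write stmt-PneNP-18538 LensBarrierP4g18.lean`.
FRONTIER (formula-depth / KRW rung); nothing here bears on P vs NP.
-/
import Mathlib
import Summits.PneNP.PneNP.Theses.KrwChromaticSteering
import Literature.Computability.Complexity.KRWComposition

/-!
# Barrier inversion on `StrongComposition` (C1), generation 18 — two kernel results
# (Theorem A: the lifting door is shut; Theorem L⁺: C1 holds on the label-or-affine class, unconditionally;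
# Theorem 3/2: the parity-KW complexity of an affine disperser is 3n/2 ± O(log n), both bounds)

The lens asks: for each recorded obstruction to proving C1 (`∃ c ∀ m n f ∃ g ∀ P, P solves
KW_f ⊛ KW_g strongly ⇒ ∃ Q solving KW_f, depth Q + n ≤ depth P + c·(log(mn)+1)`), what must an
argument look like to sit OUTSIDE the obstruction's technique class — and can that shape be typed?
The memo `LensBarrierP4g18.md` has the census.  This file proves the two statements it rests on.

## §1  The lifting door is shut for the UNLAYERED game (Theorem A, `KWEmbedding.collision`)

Obstruction F2/H (randomised easiness, rank/IC caps) kills every "analytic" measure; the one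
technique class outside it that proves tight deterministic communication bounds for SEARCH problems is
Raz–McKenzie / Göös–Pitassi–Watson SIMULATION LIFTING (Index- or inner-product-lifted search problems,
e.g. `Search(CNF) ∘ Indₗ`).  To use it on C1 one must host a lifted search problem inside a KW-type
game: Alice's lifted input `x ∈ [ℓ]ⁿ` becomes a string `A x`, Bob's tables `y` a string `B y`, and
every coordinate `k` with `A x k ≠ B y k` must REVEAL a solution from a menu `Sol k` (this is what
"`KW_g` is at least as hard as the lifted problem, by a protocol-free reduction" means).  Theorem A:
for the dense-find problem (promise: `≥ d` ones in `z = (yᵢ(xᵢ))ᵢ`; task: output a one) every such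
hosting with menus of size `≤ n − d` has a COLLISION `A x = B y` on a promise pair — so it is not a
KW-type relation at all.  The proof is a two-step pinning (`yᵏ ≡ 𝟙[i ∉ Sol k]` makes bit `k` of `A`
constant; `xᵏ` then transports it to `B y⋆`).  Consequence (memo §2): simulation lifting cannot enter
the unlayered strong game through the inner function; the only lifting-shaped residue is a
LAYER-CONFINED simulation theorem for monotone/slice hosts, which nobody has (memo §2.3, with the
gadget-size arithmetic against p5's scale door).

## §2  The first ENTANGLED protocol class on which C1 is a theorem (class L⁺, `depth_lower_bound`)

Obstruction M3/R2 (p5 g17): every typed adversary so far is SEPARABLE (per-row potentials), and C1 is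
proved only for LABEL-PUBLIC protocols (each node tests the own label vector, or one publicly named
row).  Typed just outside: class **L⁺** — every node test is a LABEL test `φ(g(X₁),…,g(X_m))` or an
AFFINE test over 𝔽₂ of the own matrix with ARBITRARY support (parities coupling many rows: genuinely
entangled deposits, outside every separable potential).  Theorem (`depth_lower_bound`): if `g` is
label-universal up to `q` equations (`MatrixLU g m q`: every satisfiable system of `≤ q` parity
equations on `m × n` matrices realises EVERY label vector) and every `KW_f` tree has
depth `≥ ℓ`, then every L⁺ protocol for the strong game has depth `≥ ℓ + q − 1`.  §5 proves
`MatrixLUOfGeneric` (an affine disperser `g` for dimension `r + 1` is label-universal up to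
`n − r − 1` equations, for every `m` — row-by-row surgery, no linear algebra) and §6 proves
`AffGenericExist` (affine dispersers for dimension `2 log₂ n + 3` exist — union bound with a
translation argument for `|Sol| ≥ 2^{n−k}`).  Hence **`strongCompositionLabelAffine_holds`: C1
RESTRICTED TO L⁺ is an unconditional theorem** (`c = 4`; the proof spends `3 log₂ n + O(1)` bits of slack, independent of `m`)
(§4 types the next rung, class LRA = label ∨ public-row ∨ affine, as `StrongCompositionLRA`).

The proof is a new two-phase adversary: (LU phase) the first `q − 1` affine bits on any path are
FREE — label-universality keeps every label vector realisable, and at a leaf one more equation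
`X_ij = Y_ij` is still affordable; (collapse) once the budget is spent the adversary commits both
players to ONE label-indexed family `v ↦ F v` of solutions (Meir's `liftRows` in disguise, applied
mid-protocol), after which every affine test IS a label test and the `KW_f` adversary charges it.
Honest limits (memo §3): the theorem gives `ℓ₀ + n − O(log n)`; the L⁺-obvious protocol costs
`ℓ₀ + 2n` but is NOT optimal — see §7; arbitrary single-row tests (M3's public rows) are NOT in L⁺ —
merging them is the typed next rung `R2` (§4, `StrongCompositionLRA`).

## §7  K1b corrected: the parity-KW complexity of a disperser is `3n/2`, both bounds kernel

`parityKW_upper`: for EVERY `g`, a HYBRID protocol (Alice reveals `⌈n/2⌉` coordinates, Bob the rest,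
the colour `g z` of the public hybrid `z` says whose hidden half holds a difference, that player
reveals it) solves `KW_g` with parity (indeed single-coordinate) messages in `≤ n + ⌈n/2⌉` rounds — so
the memo's K1b target "`D(f) + 2n − O(log n)` in L⁺" was FALSE.  `parityKW_three_halves`: for every
affine disperser `g` for dimension `r + 1`, every parity protocol for `KW_g` has `2·depth ≥ 3n − 3(r+1)`
(three-claim adversary: committed-to-a-colour phases D1/D0 cost the OTHER player `n − r − 1 − |E|`,
the undecided phase keeps both colours by genericity and, when forced, makes the player who has spoken
less pay); with §6, `parityKW_three_halves_exists`: some `g` forces `3n/2 − O(log n)`.  The corrected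
conjecture K1b′ for L⁺ is `D(f) + 3n/2 − O(log n)`.

FRONTIER (formula-depth / KRW rung); nothing here bears on P vs NP.
-/

namespace Summit.PneNP.PneNP.Cruxes.StrongComposition.P4g18

open Literature.Computability.Complexity
open Literature.Computability.Complexity.KWTree

/-! ## §1  Theorem A: KW-type hostings of Index-lifted dense-find collide -/

section Embedding

variable {n ℓ N : ℕ}

/-- The Index-lifted string `z = (yᵢ(xᵢ))ᵢ`. -/
def liftZ (x : Fin n → Fin ℓ) (y : Fin n → Fin ℓ → Bool) : Fin n → Bool := fun i => y i (x i)

/-- The dense-find promise: at least `d` coordinates of the lifted string are `true`. -/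
def Dense (d : ℕ) (x : Fin n → Fin ℓ) (y : Fin n → Fin ℓ → Bool) : Prop :=
  d ≤ (Finset.univ.filter fun i => liftZ x y i = true).card

/-- A **KW-type hosting** of Index-lifted dense-find with recovery menus: Alice's lifted input `x`
is sent to a string `A x ∈ {0,1}^N`, Bob's gadget tables `y` to `B y`, and on every promise pair every
differing coordinate `k` carries a solution (a true coordinate of `z`) inside the menu `Sol k`.  This is
exactly what a protocol-free reduction "any protocol for the KW-type relation on `(A x, B y)` plus
`|Sol k|`-bounded post-processing solves dense-find" needs. -/
structure KWEmbedding (n ℓ N d : ℕ) where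
  A : (Fin n → Fin ℓ) → (Fin N → Bool)
  B : (Fin n → Fin ℓ → Bool) → (Fin N → Bool)
  Sol : Fin N → Finset (Fin n)
  sound : ∀ x y, Dense d x y → ∀ k, A x k ≠ B y k → ∃ i ∈ Sol k, liftZ x y i = true

/-- The maximally dense promise pair used in Theorem A: `x⋆ ≡ t₁`, `y⋆ᵢ = 𝟙[· = t₁]`, so `z ≡ 1`. -/
theorem dense_star (t₁ : Fin ℓ) : Dense n (fun _ : Fin n => t₁) (fun _ t => decide (t = t₁)) := by
  unfold Dense liftZ
  simp

/-- **Theorem A (collision).**  If the gadget has two distinct values and every recovery menu leaves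
room for the promise (`d + |Sol k| ≤ n`), then the hosting identifies a promise pair: `A x⋆ = B y⋆`
although `z(x⋆, y⋆) ≡ 1` (`dense_star`).  So no KW-type relation (which needs `A x ≠ B y` on promise
inputs to have any legal output) hosts lifted dense-find with menus smaller than `n − d + 1` — and a
menu of size `> n − d` is a dense-find instance of its own.  Proof: pin bit `k` of `A` with the tables
`yᵏ ≡ 𝟙[i ∉ Sol k]` (dense, no solution in the menu, for EVERY `x`), then transport it to `B y⋆` with
`xᵏ = (t₀ on Sol k, t₁ off it)`. -/
theorem KWEmbedding.collision {d : ℕ} (E : KWEmbedding n ℓ N d) {t₀ t₁ : Fin ℓ} (ht : t₀ ≠ t₁)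
    (hmenu : ∀ k, d + (E.Sol k).card ≤ n) :
    E.A (fun _ => t₁) = E.B (fun _ t => decide (t = t₁)) := by
  classical
  funext k
  have hk := hmenu k
  set S := E.Sol k with hS
  -- every pair whose lifted string is the indicator of `Sᶜ` is dense and has no solution in `S`
  have key : ∀ (x : Fin n → Fin ℓ) (y : Fin n → Fin ℓ → Bool),
      (∀ i, liftZ x y i = decide (i ∉ S)) → E.A x k = E.B y k := by
    intro x y hz
    by_contra hne
    have hdense : Dense d x y := by
      unfold Dense
      have hset : (Finset.univ.filter fun i => liftZ x y i = true) = Sᶜ := by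
        ext i
        simp [hz i]
      rw [hset, Finset.card_compl, Fintype.card_fin]
      omega
    obtain ⟨i, hi, hzi⟩ := E.sound x y hdense k hne
    rw [hz i] at hzi
    simp only [decide_eq_true_eq] at hzi
    exact hzi hi
  -- (1) bit `k` of `A` does not depend on `x`
  have hA : ∀ x x' : Fin n → Fin ℓ, E.A x k = E.A x' k := by
    intro x x'
    rw [key x (fun i _ => decide (i ∉ S)) (fun _ => rfl),
      key x' (fun i _ => decide (i ∉ S)) (fun _ => rfl)]
  -- (2) transport to `B y⋆` along `xᵏ`
  have hB : E.A (fun i => if i ∈ S then t₀ else t₁) k = E.B (fun _ t => decide (t = t₁)) k := by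
    apply key
    intro i
    by_cases hi : i ∈ S <;> simp [liftZ, hi, ht]
  rw [hA (fun _ => t₁) (fun i => if i ∈ S then t₀ else t₁), hB]

/-- Contrapositive packaging: a hosting that IS a KW-type relation on the promise (differing strings)
must have a large menu somewhere. -/
theorem KWEmbedding.exists_large_menu {d : ℕ} (E : KWEmbedding n ℓ N d) {t₀ t₁ : Fin ℓ} (ht : t₀ ≠ t₁)
    (hd : d ≤ n) (hKW : ∀ x y, Dense d x y → E.A x ≠ E.B y) : ∃ k, n < d + (E.Sol k).card := by
  by_contra hcon
  push_neg at hcon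
  have hstar := dense_star (n := n) t₁
  unfold Dense at hstar
  exact hKW _ _ (le_trans hd hstar) (E.collision ht hcon)

end Embedding

/-! ## §2  Class L⁺ (label ∨ affine node tests) and the two-phase adversary -/

section LabelAffine

variable {m n : ℕ}

/-- Parity of the entries of `X` on the support `S ⊆ [m] × [n]`. -/
def parityOn (S : Finset (Fin m × Fin n)) (X : Fin m × Fin n → Bool) : Bool :=
  Nat.bodd (S.filter fun p => X p = true).card

@[simp] theorem parityOn_singleton (p : Fin m × Fin n) (X : Fin m × Fin n → Bool) :
    parityOn {p} X = X p := by
  unfold parityOn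
  cases h : X p <;> simp [Finset.filter_singleton, h]

/-- An AFFINE node test: `X ↦ c ⊕ ⨁_{p ∈ S} X p` for some support `S` (any rows) and constant `c`. -/
def IsAffineTest (s : (Fin m × Fin n → Bool) → Bool) : Prop :=
  ∃ (S : Finset (Fin m × Fin n)) (c : Bool), ∀ X, s X = Bool.xor c (parityOn S X)

/-- A LABEL node test: a function of the own label vector `(g(X₁), …, g(X_m))` only. -/
def IsLabelTest (g : (Fin n → Bool) → Bool) (s : (Fin m × Fin n → Bool) → Bool) : Prop :=
  ∃ φ : (Fin m → Bool) → Bool, ∀ X, s X = φ (rowLabels g X)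

/-- **Class L⁺**: every node test (of either player) is a label test or an affine test. -/
def LabelAffine (g : (Fin n → Bool) → Bool) : KWTree (Fin m × Fin n) → Prop
  | .leaf _ => True
  | .alice s P Q => (IsLabelTest g s ∨ IsAffineTest s) ∧ LabelAffine g P ∧ LabelAffine g Q
  | .bob s P Q => (IsLabelTest g s ∨ IsAffineTest s) ∧ LabelAffine g P ∧ LabelAffine g Q

/-- **C1 restricted to class L⁺** (the target of this rung; `g` is still existential). -/
def StrongCompositionLabelAffine : Prop :=
  ∃ c : ℕ, ∀ m n : ℕ, 1 ≤ n → ∀ f : (Fin m → Bool) → Bool, (∃ a b, f a ≠ f b) →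
    ∃ g : (Fin n → Bool) → Bool, ∀ P : KWTree (Fin m × Fin n), LabelAffine g P → P.SolvesStrong f g →
      ∃ Q : KWTree (Fin m), Q.Solves f ∧ Q.depth + n ≤ P.depth + c * (Nat.log 2 (m * n) + 1)

/-- C1 implies its L⁺ restriction (so a refutation of the restriction refutes C1; a proof is a rung). -/
theorem labelAffine_of_strongComposition :
    Theses.KrwChromaticSteering.StrongComposition → StrongCompositionLabelAffine := by
  rintro ⟨c, h⟩
  refine ⟨c, fun m n hn f hf => ?_⟩
  obtain ⟨g, hg⟩ := h m n hn f hf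
  exact ⟨g, fun P _ hP => hg P hP⟩

/-! ### Affine systems, label-universality, rectangle hardness -/

/-- A system of parity equations on `m × n` matrices: pairs (support, right-hand side). -/
abbrev AffSys (m n : ℕ) := List (Finset (Fin m × Fin n) × Bool)

/-- `X` satisfies every equation of `E`. -/
def Sat (E : AffSys m n) (X : Fin m × Fin n → Bool) : Prop := ∀ e ∈ E, parityOn e.1 X = e.2

@[simp] theorem sat_nil (X : Fin m × Fin n → Bool) : Sat ([] : AffSys m n) X := by
  simp [Sat]

@[simp] theorem sat_cons {e : Finset (Fin m × Fin n) × Bool} {E : AffSys m n}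
    {X : Fin m × Fin n → Bool} : Sat (e :: E) X ↔ parityOn e.1 X = e.2 ∧ Sat E X := by
  simp [Sat]

/-- **Label-universality up to `q` equations**: every SATISFIABLE system of at most `q` parity
equations on `m × n` matrices has, for EVERY label vector `v ∈ {0,1}^m`, a solution whose rows carry
the labels `v`.  (For an `r`-affine-generic `g` this holds with `q = n − r − 1`, by choosing the rows
one at a time inside the projected affine subspaces, each of dimension `≥ n − q ≥ r + 1`:
stub `MatrixLUOfGeneric`.) -/
def MatrixLU (g : (Fin n → Bool) → Bool) (m q : ℕ) : Prop :=
  ∀ E : AffSys m n, E.length ≤ q → (∃ X, Sat E X) → ∀ v : Fin m → Bool, ∃ X, Sat E X ∧ rowLabels g X = v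

variable {g : (Fin n → Bool) → Bool} {f : (Fin m → Bool) → Bool} {q : ℕ}

/-- **Rectangle hardness**: no `KW_f` protocol tree of depth `< ℓ` is correct on the valid pairs of
the label rectangle `A × B`. -/
def Hard (f : (Fin m → Bool) → Bool) (ℓ : ℕ) (A B : (Fin m → Bool) → Prop) : Prop :=
  ∀ Q : KWTree (Fin m), Q.depth < ℓ →
    ∃ a b, A a ∧ B b ∧ f a = true ∧ f b = false ∧ a (Q.run a b) = b (Q.run a b)

/-- The rectangle still contains a valid pair. -/
def Live (f : (Fin m → Bool) → Bool) (A B : (Fin m → Bool) → Prop) : Prop :=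
  ∃ a b, A a ∧ B b ∧ f a = true ∧ f b = false

theorem hard_zero (A B : (Fin m → Bool) → Prop) : Hard f 0 A B :=
  fun _ h => absurd h (Nat.not_lt_zero _)

theorem Live.pos {A B : (Fin m → Bool) → Prop} (h : Live f A B) : 0 < m := by
  obtain ⟨a, b, -, -, ha, hb⟩ := h
  rcases Nat.eq_zero_or_pos m with hm | hm
  · exfalso
    subst hm
    have hab : a = b := funext fun i => i.elim0
    rw [hab, hb] at ha
    exact Bool.false_ne_true ha
  · exact hm

theorem not_hard_iff {ℓ : ℕ} {A B : (Fin m → Bool) → Prop} :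
    ¬ Hard f ℓ A B ↔ ∃ Q : KWTree (Fin m), Q.depth < ℓ ∧
      ∀ a b, A a → B b → f a = true → f b = false → a (Q.run a b) ≠ b (Q.run a b) := by
  unfold Hard
  push_neg
  exact Iff.rfl

/-- Live from hard (positive threshold). -/
theorem Hard.live {ℓ : ℕ} {A B : (Fin m → Bool) → Prop} (hH : Hard f (ℓ + 1) A B) (hm : 0 < m) :
    Live f A B := by
  obtain ⟨a, b, ha, hb, hfa, hfb, -⟩ := hH (KWTree.leaf ⟨0, hm⟩) (by simp)
  exact ⟨a, b, ha, hb, hfa, hfb⟩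

/-- The `KW_f` adversary at an Alice label test: one answer keeps the rectangle hard one level down. -/
theorem Hard.split_alice {ℓ : ℕ} {A B : (Fin m → Bool) → Prop} (hH : Hard f (ℓ + 1) A B)
    (φ : (Fin m → Bool) → Bool) : ∃ β, Hard f ℓ (fun a => A a ∧ φ a = β) B := by
  by_contra hcon
  push_neg at hcon
  obtain ⟨Q0, hQ0, h0⟩ := not_hard_iff.1 (hcon false)
  obtain ⟨Q1, hQ1, h1⟩ := not_hard_iff.1 (hcon true)
  obtain ⟨a, b, ha, hb, hfa, hfb, hab⟩ :=
    hH (KWTree.alice φ Q0 Q1) (by rw [depth_alice]; exact Nat.succ_lt_succ (max_lt hQ0 hQ1))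
  rw [run_alice] at hab
  cases hφ : φ a
  · rw [hφ, if_neg Bool.false_ne_true] at hab
    exact h0 a b ⟨ha, hφ⟩ hb hfa hfb hab
  · rw [hφ, if_pos rfl] at hab
    exact h1 a b ⟨ha, hφ⟩ hb hfa hfb hab

/-- The `KW_f` adversary at a Bob label test. -/
theorem Hard.split_bob {ℓ : ℕ} {A B : (Fin m → Bool) → Prop} (hH : Hard f (ℓ + 1) A B)
    (φ : (Fin m → Bool) → Bool) : ∃ β, Hard f ℓ A (fun b => B b ∧ φ b = β) := by
  by_contra hcon
  push_neg at hcon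
  obtain ⟨Q0, hQ0, h0⟩ := not_hard_iff.1 (hcon false)
  obtain ⟨Q1, hQ1, h1⟩ := not_hard_iff.1 (hcon true)
  obtain ⟨a, b, ha, hb, hfa, hfb, hab⟩ :=
    hH (KWTree.bob φ Q0 Q1) (by rw [depth_bob]; exact Nat.succ_lt_succ (max_lt hQ0 hQ1))
  rw [run_bob] at hab
  cases hφ : φ b
  · rw [hφ, if_neg Bool.false_ne_true] at hab
    exact h0 a b ha ⟨hb, hφ⟩ hfa hfb hab
  · rw [hφ, if_pos rfl] at hab
    exact h1 a b ha ⟨hb, hφ⟩ hfa hfb hab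

/-- Label split with the budget bookkeeping: from threshold `ℓ ≥ 1` to `ℓ - 1`, liveness kept. -/
theorem split_alice {ℓ : ℕ} {A B : (Fin m → Bool) → Prop} (hH : Hard f ℓ A B) (hne : Live f A B)
    (hℓ : 1 ≤ ℓ) (φ : (Fin m → Bool) → Bool) :
    ∃ β, Hard f (ℓ - 1) (fun a => A a ∧ φ a = β) B ∧ Live f (fun a => A a ∧ φ a = β) B := by
  obtain ⟨ℓ', rfl⟩ : ∃ ℓ', ℓ = ℓ' + 1 := ⟨ℓ - 1, by omega⟩
  simp only [Nat.add_sub_cancel]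
  rcases Nat.eq_zero_or_pos ℓ' with h0 | hpos
  · subst h0
    obtain ⟨a₀, b₀, ha₀, hb₀, hfa₀, hfb₀⟩ := hne
    exact ⟨φ a₀, hard_zero _ _, a₀, b₀, ⟨ha₀, rfl⟩, hb₀, hfa₀, hfb₀⟩
  · obtain ⟨β, hβ⟩ := hH.split_alice φ
    obtain ⟨ℓ'', rfl⟩ : ∃ ℓ'', ℓ' = ℓ'' + 1 := ⟨ℓ' - 1, by omega⟩
    exact ⟨β, hβ, hβ.live hne.pos⟩

theorem split_bob {ℓ : ℕ} {A B : (Fin m → Bool) → Prop} (hH : Hard f ℓ A B) (hne : Live f A B)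
    (hℓ : 1 ≤ ℓ) (φ : (Fin m → Bool) → Bool) :
    ∃ β, Hard f (ℓ - 1) A (fun b => B b ∧ φ b = β) ∧ Live f A (fun b => B b ∧ φ b = β) := by
  obtain ⟨ℓ', rfl⟩ : ∃ ℓ', ℓ = ℓ' + 1 := ⟨ℓ - 1, by omega⟩
  simp only [Nat.add_sub_cancel]
  rcases Nat.eq_zero_or_pos ℓ' with h0 | hpos
  · subst h0
    obtain ⟨a₀, b₀, ha₀, hb₀, hfa₀, hfb₀⟩ := hne
    exact ⟨φ b₀, hard_zero _ _, a₀, b₀, ha₀, ⟨hb₀, rfl⟩, hfa₀, hfb₀⟩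
  · obtain ⟨β, hβ⟩ := hH.split_bob φ
    obtain ⟨ℓ'', rfl⟩ : ∃ ℓ'', ℓ' = ℓ'' + 1 := ⟨ℓ' - 1, by omega⟩
    exact ⟨β, hβ, hβ.live hne.pos⟩

/-! ### The violation predicate and the two phases -/

/-- The adversary's goal at (the subtree) `P` from position `(E, A, B)`: a valid input pair, consistent
with the position, on which `P`'s answer violates the strong requirement (equal entries, OR equal labels
in the answer's row). -/
def Violates (g : (Fin n → Bool) → Bool) (f : (Fin m → Bool) → Bool) (P : KWTree (Fin m × Fin n))
    (E : AffSys m n) (A B : (Fin m → Bool) → Prop) : Prop :=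
  ∃ X Y : Fin m × Fin n → Bool, Sat E X ∧ Sat E Y ∧ A (rowLabels g X) ∧ B (rowLabels g Y) ∧
    f (rowLabels g X) = true ∧ f (rowLabels g Y) = false ∧
    (X (P.run X Y) = Y (P.run X Y) ∨ rowLabels g X (P.run X Y).1 = rowLabels g Y (P.run X Y).1)

/-- **Phase 2 (collapse = `liftRows` mid-protocol).**  Committing BOTH players to one label-indexed
family `F` of solutions of `E` turns the remaining subtree into a `KW_f` tree of the same depth
(`comap F F fst`); if that depth is below the rectangle's hardness, the `KW_f` tree errs on a valid
pair `(a, b)`, i.e. the labels agree in the answer's row. -/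
theorem phase2 (F : (Fin m → Bool) → (Fin m × Fin n → Bool)) (hF : ∀ v, rowLabels g (F v) = v)
    {E : AffSys m n} (hFE : ∀ v, Sat E (F v)) {A B : (Fin m → Bool) → Prop} {ℓ : ℕ}
    (hH : Hard f ℓ A B) (P : KWTree (Fin m × Fin n)) (hP : P.depth < ℓ) : Violates g f P E A B := by
  obtain ⟨a, b, ha, hb, hfa, hfb, hab⟩ := hH (P.comap F F Prod.fst) (by rw [depth_comap]; exact hP)
  rw [run_comap] at hab
  refine ⟨F a, F b, hFE a, hFE b, ?_, ?_, ?_, ?_, Or.inr ?_⟩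
  · rw [hF]; exact ha
  · rw [hF]; exact hb
  · rw [hF]; exact hfa
  · rw [hF]; exact hfb
  · rw [hF, hF]; exact hab

/-- Phase 2 from label-universality (the family is chosen by `MatrixLU`). -/
theorem collapse (hLU : MatrixLU g m q) {E : AffSys m n} (hsat : ∃ X, Sat E X) (hlen : E.length ≤ q)
    {A B : (Fin m → Bool) → Prop} {ℓ : ℕ} (hH : Hard f ℓ A B) {P : KWTree (Fin m × Fin n)}
    (hd : P.depth < ℓ) : Violates g f P E A B := by
  classical
  choose F hF using hLU E hlen hsat
  exact phase2 F (fun v => (hF v).2) (fun v => (hF v).1) hH P hd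

/-- Descending through an Alice node along the branch `β` the adversary chose. -/
theorem violates_alice {s : (Fin m × Fin n → Bool) → Bool} {P Q : KWTree (Fin m × Fin n)}
    {E E' : AffSys m n} {A A' B B' : (Fin m → Bool) → Prop} (β : Bool)
    (hE : ∀ X, Sat E' X → Sat E X) (hA : ∀ a, A' a → A a) (hB : ∀ b, B' b → B b)
    (hbr : ∀ X, Sat E' X → A' (rowLabels g X) → s X = β)
    (h : Violates g f (bif β then Q else P) E' A' B') : Violates g f (KWTree.alice s P Q) E A B := by
  obtain ⟨X, Y, hX, hY, hXA, hYB, hfX, hfY, hbad⟩ := h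
  have hrun : (KWTree.alice s P Q).run X Y = (bif β then Q else P).run X Y := by
    rw [run_alice, hbr X hX hXA]
    cases β <;> simp
  refine ⟨X, Y, hE X hX, hE Y hY, hA _ hXA, hB _ hYB, hfX, hfY, ?_⟩
  rw [hrun]
  exact hbad

/-- Descending through a Bob node. -/
theorem violates_bob {s : (Fin m × Fin n → Bool) → Bool} {P Q : KWTree (Fin m × Fin n)}
    {E E' : AffSys m n} {A A' B B' : (Fin m → Bool) → Prop} (β : Bool)
    (hE : ∀ X, Sat E' X → Sat E X) (hA : ∀ a, A' a → A a) (hB : ∀ b, B' b → B b)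
    (hbr : ∀ Y, Sat E' Y → B' (rowLabels g Y) → s Y = β)
    (h : Violates g f (bif β then Q else P) E' A' B') : Violates g f (KWTree.bob s P Q) E A B := by
  obtain ⟨X, Y, hX, hY, hXA, hYB, hfX, hfY, hbad⟩ := h
  have hrun : (KWTree.bob s P Q).run X Y = (bif β then Q else P).run X Y := by
    rw [run_bob, hbr Y hY hYB]
    cases β <;> simp
  refine ⟨X, Y, hE X hX, hE Y hY, hA _ hXA, hB _ hYB, hfX, hfY, ?_⟩
  rw [hrun]
  exact hbad

/-- **Phase 1 + 2 (the two-phase adversary).**  Position: common system `E` (all affine answers so far),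
label rectangle `A × B` with `KW_f`-hardness `ℓ`, free-bit budget `k` with `|E| + k + 1 ≤ q`.  If the
subtree is shallower than `ℓ + k`, the adversary reaches a violation.  Affine nodes cost budget only
(label-universality: both answers keep every label vector realisable); label nodes cost hardness (or
budget once `ℓ = 0`); budget `0` ⇒ collapse (`phase2`); a leaf with budget left ⇒ one more equation
`X_p = Y_p`. -/
theorem adversary (hLU : MatrixLU g m q) (P : KWTree (Fin m × Fin n)) :
    LabelAffine g P → ∀ (E : AffSys m n) (A B : (Fin m → Bool) → Prop) (k ℓ : ℕ),
      (∃ X, Sat E X) → E.length + k + 1 ≤ q → Hard f ℓ A B → Live f A B → P.depth < ℓ + k →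
      Violates g f P E A B := by
  classical
  induction P with
  | leaf p =>
    intro _ E A B k ℓ hsat hlen hH hne hd
    cases k with
    | zero => exact collapse hLU hsat (by omega) hH (by simpa using hd)
    | succ k =>
      obtain ⟨X₀, hX₀⟩ := hsat
      obtain ⟨a, b, ha, hb, hfa, hfb⟩ := hne
      have hlen' : ((({p}, X₀ p) :: E) : AffSys m n).length ≤ q := by
        simp only [List.length_cons]; omega
      have hsat' : ∃ X, Sat ((({p}, X₀ p) :: E) : AffSys m n) X := ⟨X₀, by simp [hX₀]⟩
      obtain ⟨X, hX, hXa⟩ := hLU _ hlen' hsat' a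
      obtain ⟨Y, hY, hYb⟩ := hLU _ hlen' hsat' b
      rw [sat_cons] at hX hY
      refine ⟨X, Y, hX.2, hY.2, ?_, ?_, ?_, ?_, Or.inl ?_⟩
      · rw [hXa]; exact ha
      · rw [hYb]; exact hb
      · rw [hXa]; exact hfa
      · rw [hYb]; exact hfb
      · have h1 : X p = X₀ p := by simpa using hX.1
        have h2 : Y p = X₀ p := by simpa using hY.1
        simp only [run_leaf]
        rw [h1, h2]
  | alice s P Q ihP ihQ =>
    intro hLA E A B k ℓ hsat hlen hH hne hd
    simp only [LabelAffine] at hLA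
    obtain ⟨hs, hPl, hQl⟩ := hLA
    cases k with
    | zero => exact collapse hLU hsat (by omega) hH (by simpa using hd)
    | succ k =>
      have IH : ∀ β : Bool, ∀ (E : AffSys m n) (A B : (Fin m → Bool) → Prop) (k ℓ : ℕ),
          (∃ X, Sat E X) → E.length + k + 1 ≤ q → Hard f ℓ A B → Live f A B →
          (bif β then Q else P).depth < ℓ + k → Violates g f (bif β then Q else P) E A B := by
        intro β
        cases β
        · exact ihP hPl
        · exact ihQ hQl
      have hdβ : ∀ β : Bool, (bif β then Q else P).depth ≤ max P.depth Q.depth := by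
        intro β
        cases β
        · exact le_max_left _ _
        · exact le_max_right _ _
      rw [depth_alice] at hd
      rcases hs with ⟨φ, hφ⟩ | ⟨S, c, hSc⟩
      · -- LABEL test: the `KW_f` adversary answers
        rcases Nat.eq_zero_or_pos ℓ with hℓ | hℓ
        · subst hℓ
          obtain ⟨a₀, b₀, ha₀, hb₀, hfa₀, hfb₀⟩ := hne
          have hV := IH (φ a₀) E (fun a => A a ∧ φ a = φ a₀) B k 0 hsat (by omega) (hard_zero _ _)
            ⟨a₀, b₀, ⟨ha₀, rfl⟩, hb₀, hfa₀, hfb₀⟩ (by have := hdβ (φ a₀); omega)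
          exact violates_alice (φ a₀) (fun _ h => h) (fun _ h => h.1) (fun _ h => h)
            (fun X _ hA' => by rw [hφ]; exact hA'.2) hV
        · obtain ⟨β, hH', hne'⟩ := split_alice hH hne hℓ φ
          have hV := IH β E (fun a => A a ∧ φ a = β) B (k + 1) (ℓ - 1) hsat hlen hH' hne'
            (by have := hdβ β; omega)
          exact violates_alice β (fun _ h => h) (fun _ h => h.1) (fun _ h => h)
            (fun X _ hA' => by rw [hφ]; exact hA'.2) hV
      · -- AFFINE test: free (budget `k + 1 → k`, one more equation)
        obtain ⟨X₀, hX₀⟩ := hsat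
        have hV := IH (Bool.xor c (parityOn S X₀)) ((S, parityOn S X₀) :: E) A B k ℓ
          ⟨X₀, by simp [hX₀]⟩ (by simp only [List.length_cons]; omega) hH hne
          (by have := hdβ (Bool.xor c (parityOn S X₀)); omega)
        exact violates_alice (Bool.xor c (parityOn S X₀)) (fun _ h => (sat_cons.1 h).2) (fun _ h => h)
          (fun _ h => h) (fun X hX _ => by
            have h1 : parityOn S X = parityOn S X₀ := (sat_cons.1 hX).1
            rw [hSc, h1]) hV
  | bob s P Q ihP ihQ =>
    intro hLA E A B k ℓ hsat hlen hH hne hd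
    simp only [LabelAffine] at hLA
    obtain ⟨hs, hPl, hQl⟩ := hLA
    cases k with
    | zero => exact collapse hLU hsat (by omega) hH (by simpa using hd)
    | succ k =>
      have IH : ∀ β : Bool, ∀ (E : AffSys m n) (A B : (Fin m → Bool) → Prop) (k ℓ : ℕ),
          (∃ X, Sat E X) → E.length + k + 1 ≤ q → Hard f ℓ A B → Live f A B →
          (bif β then Q else P).depth < ℓ + k → Violates g f (bif β then Q else P) E A B := by
        intro β
        cases β
        · exact ihP hPl
        · exact ihQ hQl
      have hdβ : ∀ β : Bool, (bif β then Q else P).depth ≤ max P.depth Q.depth := by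
        intro β
        cases β
        · exact le_max_left _ _
        · exact le_max_right _ _
      rw [depth_bob] at hd
      rcases hs with ⟨φ, hφ⟩ | ⟨S, c, hSc⟩
      · rcases Nat.eq_zero_or_pos ℓ with hℓ | hℓ
        · subst hℓ
          obtain ⟨a₀, b₀, ha₀, hb₀, hfa₀, hfb₀⟩ := hne
          have hV := IH (φ b₀) E A (fun b => B b ∧ φ b = φ b₀) k 0 hsat (by omega) (hard_zero _ _)
            ⟨a₀, b₀, ha₀, ⟨hb₀, rfl⟩, hfa₀, hfb₀⟩ (by have := hdβ (φ b₀); omega)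
          exact violates_bob (φ b₀) (fun _ h => h) (fun _ h => h) (fun _ h => h.1)
            (fun Y _ hB' => by rw [hφ]; exact hB'.2) hV
        · obtain ⟨β, hH', hne'⟩ := split_bob hH hne hℓ φ
          have hV := IH β E A (fun b => B b ∧ φ b = β) (k + 1) (ℓ - 1) hsat hlen hH' hne'
            (by have := hdβ β; omega)
          exact violates_bob β (fun _ h => h) (fun _ h => h) (fun _ h => h.1)
            (fun Y _ hB' => by rw [hφ]; exact hB'.2) hV
      · obtain ⟨X₀, hX₀⟩ := hsat
        have hV := IH (Bool.xor c (parityOn S X₀)) ((S, parityOn S X₀) :: E) A B k ℓ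
          ⟨X₀, by simp [hX₀]⟩ (by simp only [List.length_cons]; omega) hH hne
          (by have := hdβ (Bool.xor c (parityOn S X₀)); omega)
        exact violates_bob (Bool.xor c (parityOn S X₀)) (fun _ h => (sat_cons.1 h).2) (fun _ h => h)
          (fun _ h => h) (fun Y hY _ => by
            have h1 : parityOn S Y = parityOn S X₀ := (sat_cons.1 hY).1
            rw [hSc, h1]) hV

/-- **THEOREM L⁺ (depth lower bound).**  If `g` is label-universal up to `q ≥ 1` equations and every
`KW_f` tree has depth `≥ ℓ`, then every class-L⁺ protocol for the strong composition game
`KW_f ⊛ KW_g` has depth `≥ ℓ + q − 1`. -/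
theorem depth_lower_bound (hLU : MatrixLU g m q) (hq : 1 ≤ q) {ℓ : ℕ}
    (hH : Hard f ℓ (fun _ => True) (fun _ => True)) (hne : ∃ a b, f a = true ∧ f b = false)
    {P : KWTree (Fin m × Fin n)} (hP : LabelAffine g P) (hsol : P.SolvesStrong f g) :
    ℓ + (q - 1) ≤ P.depth := by
  by_contra hlt
  push_neg at hlt
  obtain ⟨a, b, hfa, hfb⟩ := hne
  obtain ⟨X, Y, -, -, -, -, hfX, hfY, hbad⟩ := adversary hLU P hP [] (fun _ => True) (fun _ => True)
    (q - 1) ℓ ⟨fun _ => false, sat_nil _⟩ (by simp only [List.length_nil]; omega) hH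
    ⟨a, b, trivial, trivial, hfa, hfb⟩
    (by omega)
  have h := hsol X Y (by rw [blockComp_apply]; exact hfX) (by rw [blockComp_apply]; exact hfY)
  rcases hbad with h' | h'
  · exact h.1 h'
  · exact h.2 h'

/-! ### The genericity hypothesis and the corollary `C1|L⁺` -/

/-- GENERICITY (proved below: `affineLUExist_of_genericExist affGenericExist_holds`, §5–§6): for every
`m, n ≥ 1` some non-constant `g : {0,1}^n → {0,1}` is label-universal on `m × n` matrices up to
`q ≥ n − c'·(log₂ n + 1)` equations.  Split into `MatrixLUOfGeneric` (row surgery) and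
`AffGenericExist` (affine dispersers exist). -/
def AffineLUExist : Prop :=
  ∃ c' : ℕ, ∀ m n : ℕ, 1 ≤ n → ∃ g : (Fin n → Bool) → Bool,
    (∃ u v, g u = true ∧ g v = false) ∧ ∃ q : ℕ, n ≤ q + c' * (Nat.log 2 n + 1) ∧ MatrixLU g m q

/-- **COROLLARY (C1 on class L⁺, modulo the genericity stub).** -/
theorem strongCompositionLabelAffine_of_LU (h : AffineLUExist) : StrongCompositionLabelAffine := by
  obtain ⟨c', hc'⟩ := h
  refine ⟨c' + 1, fun m n hn f hf => ?_⟩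
  obtain ⟨g, ⟨u, v, hu, hv⟩, q, hq, hLU⟩ := hc' m n hn
  refine ⟨g, fun P hP hsol => ?_⟩
  have hne : ∃ a b, f a = true ∧ f b = false := by
    obtain ⟨a, b, hab⟩ := hf
    cases ha : f a <;> cases hb : f b
    · rw [ha, hb] at hab; exact absurd rfl hab
    · exact ⟨b, a, hb, ha⟩
    · exact ⟨a, b, ha, hb⟩
    · rw [ha, hb] at hab; exact absurd rfl hab
  have hm : 0 < m := by
    obtain ⟨a, b, hab⟩ := hf
    rcases Nat.eq_zero_or_pos m with h0 | h0
    · exfalso; subst h0; exact hab (congrArg f (funext fun i => i.elim0))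
    · exact h0
  set L := Nat.log 2 (m * n) + 1 with hL
  have hLn : Nat.log 2 n + 1 ≤ L := by
    have : Nat.log 2 n ≤ Nat.log 2 (m * n) := Nat.log_mono_right (Nat.le_mul_of_pos_left n hm)
    omega
  have hT : c' * (Nat.log 2 n + 1) ≤ c' * L := Nat.mul_le_mul_left _ hLn
  have hsplit : (c' + 1) * L = c' * L + L := by ring
  rcases Nat.eq_zero_or_pos q with hq0 | hq0
  · -- no budget: the `liftRows` protocol already fits
    refine ⟨P.comap (liftRows u v) (liftRows u v) Prod.fst, solves_comap_liftRows hsol hu hv, ?_⟩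
    rw [depth_comap]
    subst hq0
    omega
  · by_contra hcon
    push_neg at hcon
    have hH : Hard f (P.depth + (c' + 1) * L + 1 - n) (fun _ => True) (fun _ => True) := by
      intro Q hQ
      have hns : ¬ Q.Solves f := fun hs => by have := hcon Q hs; omega
      unfold KWTree.Solves at hns
      push_neg at hns
      obtain ⟨a, b, ha, hb, hab⟩ := hns
      exact ⟨a, b, trivial, trivial, ha, hb, hab⟩
    have hmain := depth_lower_bound hLU hq0 hH hne hP hsol
    omega

/-! ### The two halves of `AffineLUExist` (both PROVED below, §5 and §6) -/

/-- Parity of `x` on a support `S ⊆ [n]` (one row). -/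
def rowParity (S : Finset (Fin n)) (x : Fin n → Bool) : Bool := Nat.bodd (S.filter fun j => x j = true).card

/-- `r`-AFFINE-GENERICITY of `g` by equations: on the solution set of every satisfiable system of at
most `n − r − 1` parity equations on `{0,1}^n` (an affine subspace of dimension `≥ r + 1`), `g` takes
both values. -/
def AffGeneric (g : (Fin n → Bool) → Bool) (r : ℕ) : Prop :=
  ∀ E : List (Finset (Fin n) × Bool), E.length + r + 1 ≤ n →
    (∃ x, ∀ e ∈ E, rowParity e.1 x = e.2) → ∀ β : Bool, ∃ x, (∀ e ∈ E, rowParity e.1 x = e.2) ∧ g x = β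

/-- Half 1 (proved in §5, `matrixLUOfGeneric_holds`): an `r`-generic non-constant `g` is
label-universal on matrices up to `n − r − 1` equations, for every number of rows `m`.  Why true: fix
rows `1..i−1`; the remaining solution set projects onto row `i` as an affine subspace of dimension
`≥ n − q ≥ r + 1` (a projection of a codimension-`≤ q` flat), on which `g` hits the wanted label. -/
def MatrixLUOfGeneric : Prop :=
  ∀ (m n r : ℕ) (g : (Fin n → Bool) → Bool), (∃ u v, g u = true ∧ g v = false) →
    AffGeneric g r → MatrixLU g m (n - r - 1)

/-- Half 2 (proved in §6, `affGenericExist_holds`, with `c₀ = 2`): for `r = c₀·(log₂ n + 1)` a uniformly random `g` is `r`-generic w.h.p.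
(`#{affine flats of dim d} ≤ 2^{n(d+1)}`, each monochromatic with probability `2^{1−2^d}`). -/
def AffGenericExist : Prop :=
  ∃ c₀ : ℕ, ∀ n : ℕ, 1 ≤ n → ∃ g : (Fin n → Bool) → Bool,
    (∃ u v, g u = true ∧ g v = false) ∧ AffGeneric g (c₀ * (Nat.log 2 n + 1))

/-- The two stubs give the hypothesis of the corollary. -/
theorem affineLUExist_of_stubs (h₁ : MatrixLUOfGeneric) (h₂ : AffGenericExist) : AffineLUExist := by
  obtain ⟨c₀, hc₀⟩ := h₂
  refine ⟨c₀ + 1, fun m n hn => ?_⟩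
  obtain ⟨g, hg, hgen⟩ := hc₀ n hn
  refine ⟨g, hg, n - c₀ * (Nat.log 2 n + 1) - 1, ?_, h₁ m n _ g hg hgen⟩
  have hsplit : (c₀ + 1) * (Nat.log 2 n + 1) = c₀ * (Nat.log 2 n + 1) + (Nat.log 2 n + 1) := by ring
  omega

/-- Hence: the two stubs prove C1 on class L⁺. -/
theorem strongCompositionLabelAffine_of_stubs (h₁ : MatrixLUOfGeneric) (h₂ : AffGenericExist) :
    StrongCompositionLabelAffine :=
  strongCompositionLabelAffine_of_LU (affineLUExist_of_stubs h₁ h₂)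

end LabelAffine

/-! ## §4  The next rung, typed: class LRA = label ∨ public-row ∨ affine (stub K2 of the card)

`LabelRowAffine g P` is the join of p5's separable class M3 (`LabelPublic`: label tests and PUBLIC ROW tests
`X ↦ ψ (row X i)`, `i` fixed at the node) with class L⁺ above.  It contains the standard composed protocol
(labels by a `KW_f` protocol, then `KW_g` on the answer row), so `StrongCompositionLRA` below is the first
rung on which the free-affine-answer mechanism (§2) meets a half-played row game (M3's row potentials).
Recorded here as a TYPED TARGET only (no proof is claimed): `C1 → C1|LRA → C1|L⁺`. -/
section LRA
variable {m n : ℕ}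

/-- A PUBLIC ROW node test: a function of one own row `X_i`, `i` fixed at the node (as in M3). -/
def IsRowTest (s : (Fin m × Fin n → Bool) → Bool) : Prop :=
  ∃ (i : Fin m) (ψ : (Fin n → Bool) → Bool), ∀ X, s X = ψ (row X i)

/-- **Class LRA**: every node test is a label test, a public row test, or an affine test. -/
def LabelRowAffine (g : (Fin n → Bool) → Bool) : KWTree (Fin m × Fin n) → Prop
  | .leaf _ => True
  | .alice s P Q => (IsLabelTest g s ∨ IsRowTest s ∨ IsAffineTest s) ∧ LabelRowAffine g P ∧ LabelRowAffine g Q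
  | .bob s P Q => (IsLabelTest g s ∨ IsRowTest s ∨ IsAffineTest s) ∧ LabelRowAffine g P ∧ LabelRowAffine g Q

theorem LabelAffine.labelRowAffine {g : (Fin n → Bool) → Bool} :
    ∀ {P : KWTree (Fin m × Fin n)}, LabelAffine g P → LabelRowAffine g P
  | .leaf _, _ => trivial
  | .alice _ _ _, ⟨h, hP, hQ⟩ =>
      ⟨h.elim Or.inl (fun h' => Or.inr (Or.inr h')), hP.labelRowAffine, hQ.labelRowAffine⟩
  | .bob _ _ _, ⟨h, hP, hQ⟩ =>
      ⟨h.elim Or.inl (fun h' => Or.inr (Or.inr h')), hP.labelRowAffine, hQ.labelRowAffine⟩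

/-- **C1 restricted to class LRA** (stub K2: the next rung after `StrongCompositionLabelAffine`). -/
def StrongCompositionLRA : Prop :=
  ∃ c : ℕ, ∀ m n : ℕ, 1 ≤ n → ∀ f : (Fin m → Bool) → Bool, (∃ a b, f a ≠ f b) →
    ∃ g : (Fin n → Bool) → Bool, ∀ P : KWTree (Fin m × Fin n), LabelRowAffine g P → P.SolvesStrong f g →
      ∃ Q : KWTree (Fin m), Q.Solves f ∧ Q.depth + n ≤ P.depth + c * (Nat.log 2 (m * n) + 1)

theorem lra_of_strongComposition :
    Theses.KrwChromaticSteering.StrongComposition → StrongCompositionLRA := by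
  rintro ⟨c, h⟩
  refine ⟨c, fun m n hn f hf => ?_⟩
  obtain ⟨g, hg⟩ := h m n hn f hf
  exact ⟨g, fun P _ hP => hg P hP⟩

theorem labelAffine_of_lra : StrongCompositionLRA → StrongCompositionLabelAffine := by
  rintro ⟨c, h⟩
  refine ⟨c, fun m n hn f hf => ?_⟩
  obtain ⟨g, hg⟩ := h m n hn f hf
  exact ⟨g, fun P hL hP => hg P hL.labelRowAffine hP⟩

end LRA

/-! ## §5  STUB 1 discharged: `MatrixLUOfGeneric` holds (row-by-row surgery, no linear algebra)

Freeze all rows except `i` at a current solution `X`: the system `E` restricted to row `i` is a system of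
`≤ |E|` parity equations on `{0,1}^n` (`restrictRow`), satisfied by `row X i`; genericity gives a row `y`
with the wanted label satisfying it, and `setRow X i y` still satisfies `E`.  Induct over the rows. -/
section Stub1
variable {m n : ℕ}

/-- Replace row `i` of `X` by `y`. -/
def setRow (X : Fin m × Fin n → Bool) (i : Fin m) (y : Fin n → Bool) : Fin m × Fin n → Bool :=
  fun p => if p.1 = i then y p.2 else X p

@[simp] theorem row_setRow_same (X : Fin m × Fin n → Bool) (i : Fin m) (y : Fin n → Bool) :
    row (setRow X i y) i = y := by
  funext j; simp [row, setRow]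

theorem row_setRow_of_ne (X : Fin m × Fin n → Bool) {i i' : Fin m} (y : Fin n → Bool) (h : i' ≠ i) :
    row (setRow X i y) i' = row X i' := by
  funext j; simp [row, setRow, h]

@[simp] theorem setRow_row_self (X : Fin m × Fin n → Bool) (i : Fin m) : setRow X i (row X i) = X := by
  funext p
  rcases p with ⟨i', j⟩
  by_cases h : i' = i
  · subst h; simp [setRow, row]
  · simp [setRow, h]

/-- The row-`i` part of a support, as a subset of `[n]`. -/
def rowSupp (S : Finset (Fin m × Fin n)) (i : Fin m) : Finset (Fin n) :=
  (S.filter fun p => p.1 = i).image Prod.snd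

/-- The off-row-`i` part of a support. -/
def offRow (S : Finset (Fin m × Fin n)) (i : Fin m) : Finset (Fin m × Fin n) :=
  S.filter fun p => p.1 ≠ i

theorem parityOn_setRow (S : Finset (Fin m × Fin n)) (X : Fin m × Fin n → Bool) (i : Fin m)
    (y : Fin n → Bool) :
    parityOn S (setRow X i y) = Bool.xor (rowParity (rowSupp S i) y) (parityOn (offRow S i) X) := by
  unfold parityOn rowParity
  have hsplit : S.filter (fun p => setRow X i y p = true)
      = (S.filter fun p => p.1 = i).filter (fun p => y p.2 = true)
        ∪ (offRow S i).filter (fun p => X p = true) := by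
    ext p
    rcases p with ⟨i', j⟩
    simp only [Finset.mem_filter, Finset.mem_union, offRow]
    by_cases h : i' = i
    · subst h; simp [setRow]
    · simp [setRow, h]
  have hdisj : Disjoint ((S.filter fun p => p.1 = i).filter (fun p => y p.2 = true))
      ((offRow S i).filter (fun p => X p = true)) := by
    rw [Finset.disjoint_left]
    intro p hp hq
    simp only [Finset.mem_filter, offRow] at hp hq
    exact hq.1.2 hp.1.2
  have hcard : ((S.filter fun p => p.1 = i).filter (fun p => y p.2 = true)).card
      = ((rowSupp S i).filter fun j => y j = true).card := by
    unfold rowSupp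
    rw [Finset.filter_image, Finset.card_image_of_injOn]
    rintro ⟨i₁, j₁⟩ hp ⟨i₂, j₂⟩ hq h
    simp only [Finset.coe_filter, Set.mem_setOf_eq, Finset.mem_filter] at hp hq
    simp only at h
    subst h
    rcases hp with ⟨⟨_, rfl⟩, _⟩
    rcases hq with ⟨⟨_, rfl⟩, _⟩
    rfl
  rw [hsplit, Finset.card_union_of_disjoint hdisj, Nat.bodd_add, hcard]

/-- The system `E` restricted to row `i`, the other rows frozen at `X`. -/
def restrictRow (E : AffSys m n) (i : Fin m) (X : Fin m × Fin n → Bool) :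
    List (Finset (Fin n) × Bool) :=
  E.map fun e => (rowSupp e.1 i, Bool.xor e.2 (parityOn (offRow e.1 i) X))

theorem sat_setRow_iff (E : AffSys m n) (i : Fin m) (X : Fin m × Fin n → Bool) (y : Fin n → Bool) :
    Sat E (setRow X i y) ↔ ∀ e ∈ restrictRow E i X, rowParity e.1 y = e.2 := by
  simp only [Sat, restrictRow, List.mem_map, forall_exists_index, and_imp]
  constructor
  · rintro h _ e he rfl
    have h1 := h e he
    rw [parityOn_setRow] at h1
    rw [← h1]
    cases rowParity (rowSupp e.1 i) y <;> cases parityOn (offRow e.1 i) X <;> rfl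
  · intro h e he
    have h1 := h _ e he rfl
    rw [parityOn_setRow, h1]
    cases e.2 <;> cases parityOn (offRow e.1 i) X <;> rfl

/-- **STUB 1 holds.** -/
theorem matrixLUOfGeneric_holds : MatrixLUOfGeneric := by
  intro m n r g hg hgen E hlen hsat v
  obtain ⟨u, w, hu, hw⟩ := hg
  by_cases hr : r + 1 ≤ n
  swap
  · have hE : E = [] := List.eq_nil_of_length_eq_zero (by omega)
    subst hE
    refine ⟨fun p => if v p.1 = true then u p.2 else w p.2, sat_nil _, ?_⟩
    funext i
    simp only [rowLabels_apply]
    cases hvi : v i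
    · have : row (fun p : Fin m × Fin n => if v p.1 = true then u p.2 else w p.2) i = w := by
        funext j; simp [row, hvi]
      rw [this, hw]
    · have : row (fun p : Fin m × Fin n => if v p.1 = true then u p.2 else w p.2) i = u := by
        funext j; simp [row, hvi]
      rw [this, hu]
  · have key : ∀ k, k ≤ m → ∃ X, Sat E X ∧ ∀ i : Fin m, i.val < k → g (row X i) = v i := by
      intro k
      induction k with
      | zero =>
        intro _
        obtain ⟨X, hX⟩ := hsat
        exact ⟨X, hX, fun i hi => absurd hi (Nat.not_lt_zero _)⟩
      | succ k ih =>
        intro hk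
        obtain ⟨X, hX, hlab⟩ := ih (by omega)
        obtain ⟨i, hi⟩ : ∃ i : Fin m, i.val = k := ⟨⟨k, by omega⟩, rfl⟩
        have hEi : (restrictRow E i X).length + r + 1 ≤ n := by
          simp only [restrictRow, List.length_map]; omega
        have hsat_i : ∃ y, ∀ e ∈ restrictRow E i X, rowParity e.1 y = e.2 :=
          ⟨row X i, (sat_setRow_iff E i X (row X i)).1 (by simpa using hX)⟩
        obtain ⟨y, hy, hgy⟩ := hgen _ hEi hsat_i (v i)
        refine ⟨setRow X i y, (sat_setRow_iff E i X y).2 hy, fun i' hi' => ?_⟩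
        by_cases h : i' = i
        · subst h; simpa using hgy
        · rw [row_setRow_of_ne _ _ h]
          have : i'.val ≠ k := fun hh => h (Fin.ext (hh.trans hi.symm))
          exact hlab i' (by omega)
    obtain ⟨X, hX, hlab⟩ := key m le_rfl
    exact ⟨X, hX, funext fun i => by simpa using hlab i i.isLt⟩

/-- Hence C1 on class L⁺ depends on the counting stub `AffGenericExist` alone. -/
theorem affineLUExist_of_genericExist (h : AffGenericExist) : AffineLUExist :=
  affineLUExist_of_stubs matrixLUOfGeneric_holds h

theorem strongCompositionLabelAffine_of_genericExist (h : AffGenericExist) :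
    StrongCompositionLabelAffine :=
  strongCompositionLabelAffine_of_LU (affineLUExist_of_genericExist h)

end Stub1

/-! ## §6  STUB 2 discharged: `AffGenericExist` holds (affine dispersers for dimension `2 log₂ n + 3`
exist, by the union bound)

`g ↦` "constant on the solution set of some satisfiable system of `≤ n − r − 1` equations" has fewer
than `2^{2^n}` members: a satisfiable system of `k` equations has `≥ 2^{n−k}` solutions (translation
argument, no linear algebra), functions constant on a set `T` number `≤ 2^{2^n − |T|}`, systems (padded
to length exactly `n − r − 1`) number `≤ 2^{(n+1)(n−r−1)}`, and `(n+1)(n−r−1) + 2 ≤ n² < 2^{r+1}` for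
`r = 2 (log₂ n + 1)`. -/
section Stub2
variable {n : ℕ}

theorem rowParity_insert {S : Finset (Fin n)} {j : Fin n} (h : j ∉ S) (x : Fin n → Bool) :
    rowParity (insert j S) x = Bool.xor (x j) (rowParity S x) := by
  unfold rowParity
  rw [Finset.filter_insert]
  by_cases hx : x j = true
  · rw [if_pos hx, Finset.card_insert_of_notMem (by simp [Finset.mem_filter, h]), Nat.bodd_add, hx]
    cases Nat.bodd (S.filter fun j => x j = true).card <;> rfl
  · rw [if_neg hx]
    simp only [Bool.not_eq_true] at hx
    rw [hx]
    cases Nat.bodd (S.filter fun j => x j = true).card <;> rfl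

/-- Pointwise xor of two vectors. -/
def bxorVec (x y : Fin n → Bool) : Fin n → Bool := fun j => Bool.xor (x j) (y j)

theorem rowParity_bxorVec (S : Finset (Fin n)) (x y : Fin n → Bool) :
    rowParity S (bxorVec x y) = Bool.xor (rowParity S x) (rowParity S y) := by
  induction S using Finset.induction_on with
  | empty => simp [rowParity]
  | insert j S hj ih =>
    rw [rowParity_insert hj, rowParity_insert hj, rowParity_insert hj, ih]
    simp only [bxorVec]
    cases x j <;> cases y j <;> cases rowParity S x <;> cases rowParity S y <;> rfl

/-- A satisfiable system of `k` parity equations on `{0,1}^n` has at least `2^{n-k}` solutions. -/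
theorem two_pow_le_card_sol (E : List (Finset (Fin n) × Bool))
    (hsat : ∃ x, ∀ e ∈ E, rowParity e.1 x = e.2) :
    2 ^ (n - E.length) ≤
      (Finset.univ.filter fun x : Fin n → Bool => ∀ e ∈ E, rowParity e.1 x = e.2).card := by
  induction E with
  | nil => simp
  | cons e E ih =>
    obtain ⟨x₀, hx₀⟩ := hsat
    have hx₀E : ∀ e' ∈ E, rowParity e'.1 x₀ = e'.2 := fun e' he' => hx₀ e' (List.mem_cons_of_mem _ he')
    have hx₀e : rowParity e.1 x₀ = e.2 := hx₀ e List.mem_cons_self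
    have ih' := ih ⟨x₀, hx₀E⟩
    set T := Finset.univ.filter (fun x : Fin n → Bool => ∀ e' ∈ E, rowParity e'.1 x = e'.2) with hT
    have hT1eq : (Finset.univ.filter fun x : Fin n → Bool => ∀ e' ∈ e :: E, rowParity e'.1 x = e'.2)
        = T.filter fun x => rowParity e.1 x = e.2 := by
      ext x
      simp only [Finset.mem_filter, Finset.mem_univ, true_and, List.forall_mem_cons, hT]
      exact and_comm
    rw [hT1eq]
    have hsplit := Finset.filter_card_add_filter_neg_card_eq_card
      (s := T) (fun x => rowParity e.1 x = e.2)
    have hle : (T.filter fun x => ¬ rowParity e.1 x = e.2).card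
        ≤ (T.filter fun x => rowParity e.1 x = e.2).card := by
      by_cases h0 : (T.filter fun x => ¬ rowParity e.1 x = e.2) = ∅
      · rw [h0]; simp
      · obtain ⟨x₁, hx₁⟩ := Finset.nonempty_iff_ne_empty.mpr h0
        simp only [Finset.mem_filter, hT, Finset.mem_univ, true_and] at hx₁
        apply Finset.card_le_card_of_injOn (fun x => bxorVec (bxorVec x x₀) x₁)
        · intro x hx
          simp only [Finset.coe_filter, Finset.mem_filter, Finset.mem_univ, true_and, hT,
            Set.mem_setOf_eq] at hx ⊢
          refine ⟨fun e' he' => ?_, ?_⟩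
          · rw [rowParity_bxorVec, rowParity_bxorVec, hx.1 e' he', hx₀E e' he', hx₁.1 e' he']
            cases e'.2 <;> rfl
          · rw [rowParity_bxorVec, rowParity_bxorVec, hx₀e]
            have h1 := hx.2
            have h2 := hx₁.2
            revert h1 h2
            cases rowParity e.1 x <;> cases rowParity e.1 x₁ <;> cases e.2 <;> simp
        · intro x _ x' _ h
          funext j
          have := congr_fun h j
          simp only [bxorVec] at this
          revert this
          cases x j <;> cases x' j <;> cases x₀ j <;> cases x₁ j <;> simp
    have h1 : 1 ≤ (T.filter fun x => rowParity e.1 x = e.2).card := by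
      apply Finset.card_pos.mpr
      refine ⟨x₀, ?_⟩
      rw [Finset.mem_filter, hT]
      exact ⟨by simp only [Finset.mem_filter, Finset.mem_univ, true_and]; exact hx₀E, hx₀e⟩
    rcases Nat.eq_zero_or_pos (n - E.length) with hz | hpos
    · have : n - (e :: E).length = 0 := by simp only [List.length_cons]; omega
      rw [this]; simpa using h1
    · have heq : n - E.length = (n - (e :: E).length) + 1 := by simp only [List.length_cons]; omega
      rw [heq, pow_succ] at ih'
      omega

/-- Boolean functions on `{0,1}^n` that are constant `= b` on `T` number at most `2^{2^n − |T|}`. -/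
theorem card_const_on_le (T : Finset (Fin n → Bool)) (b : Bool) :
    (Finset.univ.filter fun g : (Fin n → Bool) → Bool => ∀ x ∈ T, g x = b).card
      ≤ 2 ^ (2 ^ n - T.card) := by
  have hc : Fintype.card ({x : Fin n → Bool // x ∉ T} → Bool) = 2 ^ (2 ^ n - T.card) := by
    rw [Fintype.card_fun, Fintype.card_bool, Fintype.card_subtype_compl, Fintype.card_coe]
    simp [Fintype.card_fun, Fintype.card_bool, Fintype.card_fin]
  rw [← hc, ← Finset.card_univ]
  apply Finset.card_le_card_of_injOn (fun g => fun x : {x : Fin n → Bool // x ∉ T} => g x.1)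
  · intro g _; simp
  · intro g hg g' hg' h
    simp only [Finset.coe_filter, Finset.mem_univ, true_and, Set.mem_setOf_eq] at hg hg'
    funext x
    by_cases hx : x ∈ T
    · rw [hg x hx, hg' x hx]
    · exact congr_fun h ⟨x, hx⟩

/-- **STUB 2 holds** (with `c₀ = 2`). -/
theorem affGenericExist_holds : AffGenericExist := by
  classical
  refine ⟨2, fun n hn => ?_⟩
  by_cases hrn : 2 * (Nat.log 2 n + 1) + 1 ≤ n
  swap
  · refine ⟨fun x => x ⟨0, by omega⟩, ⟨fun _ => true, fun _ => false, rfl, rfl⟩, ?_⟩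
    intro E hE; exfalso; omega
  · set L := Nat.log 2 n with hL
    set r := 2 * (L + 1) with hr
    set N := n - r - 1 with hN
    have hNr : n - N = r + 1 := by omega
    -- the bad set
    set SatR : List (Finset (Fin n) × Bool) → (Fin n → Bool) → Prop :=
      fun E x => ∀ e ∈ E, rowParity e.1 x = e.2 with hSatR
    set Piece : (Fin N → Finset (Fin n) × Bool) → Bool → Finset ((Fin n → Bool) → Bool) :=
      fun σ b => Finset.univ.filter fun g =>
        (∃ x, SatR (List.ofFn σ) x) ∧ ∀ x, SatR (List.ofFn σ) x → g x = b with hPiece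
    set Bad : Finset ((Fin n → Bool) → Bool) :=
      (Finset.univ : Finset (Fin N → Finset (Fin n) × Bool)).biUnion fun σ =>
        (Finset.univ : Finset Bool).biUnion fun b => Piece σ b with hBad
    -- each piece is small
    have hterm : ∀ (σ : Fin N → Finset (Fin n) × Bool) (b : Bool),
        (Piece σ b).card ≤ 2 ^ (2 ^ n - 2 ^ (r + 1)) := by
      intro σ b
      by_cases hσ : ∃ x, SatR (List.ofFn σ) x
      · set T := Finset.univ.filter (fun x => SatR (List.ofFn σ) x) with hT
        have hTc : 2 ^ (n - (List.ofFn σ).length) ≤ T.card := two_pow_le_card_sol _ hσ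
        rw [List.length_ofFn, hNr] at hTc
        calc (Piece σ b).card
            ≤ (Finset.univ.filter fun g : (Fin n → Bool) → Bool => ∀ x ∈ T, g x = b).card := by
              apply Finset.card_le_card
              intro g hg
              simp only [hPiece, Finset.mem_filter, Finset.mem_univ, true_and, hT] at hg ⊢
              intro x hx
              exact hg.2 x hx
          _ ≤ 2 ^ (2 ^ n - T.card) := card_const_on_le T b
          _ ≤ 2 ^ (2 ^ n - 2 ^ (r + 1)) := Nat.pow_le_pow_right (by norm_num) (by omega)
      · have : Piece σ b = ∅ := by
          rw [hPiece]
          apply Finset.filter_eq_empty_iff.mpr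
          intro g _ h
          exact hσ h.1
        rw [this]; simp
    -- the bad set is not everything
    have hlog : n < 2 ^ (L + 1) := Nat.lt_pow_succ_log_self one_lt_two n
    have hcardσ : Fintype.card (Fin N → Finset (Fin n) × Bool) = 2 ^ ((n + 1) * N) := by
      rw [Fintype.card_fun, Fintype.card_prod, Fintype.card_finset, Fintype.card_bool,
        Fintype.card_fin, Fintype.card_fin, ← pow_succ, ← pow_mul]
    have hexp : (n + 1) * N + 1 < 2 ^ (r + 1) := by
      have hN3 : N + 3 ≤ n := by omega
      have h1 : (n + 1) * N + 2 ≤ n * n := by nlinarith [Nat.mul_le_mul_left (n + 1) hN3]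
      have h2 : n * n < 2 ^ (L + 1) * 2 ^ (L + 1) := Nat.mul_lt_mul'' hlog hlog
      have h3 : 2 ^ (L + 1) * 2 ^ (L + 1) ≤ 2 ^ (r + 1) := by
        rw [← pow_add]; exact Nat.pow_le_pow_right (by norm_num) (by omega)
      exact lt_of_lt_of_le (lt_of_lt_of_le (Nat.lt_succ_of_le le_rfl) h1) (le_trans h2.le h3) |>.trans_le le_rfl
    have hpow : 2 ^ (r + 1) ≤ 2 ^ n := Nat.pow_le_pow_right (by norm_num) hrn
    have hA : 2 ^ (2 ^ n) = 2 ^ (2 ^ (r + 1)) * 2 ^ (2 ^ n - 2 ^ (r + 1)) := by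
      rw [← pow_add]; congr 1; omega
    have hBadlt : Bad.card < 2 ^ (2 ^ n) := by
      calc Bad.card ≤ ∑ σ : Fin N → Finset (Fin n) × Bool, ∑ b : Bool, (Piece σ b).card := by
              refine Finset.card_biUnion_le.trans ?_
              apply Finset.sum_le_sum; intro σ _; exact Finset.card_biUnion_le
        _ ≤ ∑ σ : Fin N → Finset (Fin n) × Bool, ∑ b : Bool, 2 ^ (2 ^ n - 2 ^ (r + 1)) := by
              apply Finset.sum_le_sum; intro σ _; apply Finset.sum_le_sum; intro b _; exact hterm σ b
        _ = 2 ^ ((n + 1) * N) * (2 * 2 ^ (2 ^ n - 2 ^ (r + 1))) := by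
              simp only [Finset.sum_const, Finset.card_univ, hcardσ, Fintype.card_bool, smul_eq_mul]
        _ = 2 ^ ((n + 1) * N + 1) * 2 ^ (2 ^ n - 2 ^ (r + 1)) := by ring
        _ < 2 ^ (2 ^ (r + 1)) * 2 ^ (2 ^ n - 2 ^ (r + 1)) :=
              Nat.mul_lt_mul_of_pos_right (Nat.pow_lt_pow_right (by norm_num) hexp) (by positivity)
        _ = 2 ^ (2 ^ n) := hA.symm
    have huniv : (Finset.univ : Finset ((Fin n → Bool) → Bool)).card = 2 ^ (2 ^ n) := by
      simp [Finset.card_univ, Fintype.card_fun, Fintype.card_bool, Fintype.card_fin]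
    obtain ⟨g, -, hg⟩ : ∃ g, g ∈ (Finset.univ : Finset ((Fin n → Bool) → Bool)) ∧ g ∉ Bad :=
      Finset.exists_mem_notMem_of_card_lt_card (by rw [huniv]; exact hBadlt)
    -- `g ∉ Bad` is genericity
    have hgen : AffGeneric g r := by
      intro E hE hsat β
      by_contra hc
      push_neg at hc
      apply hg
      -- pad `E` to length `N`
      let σ : Fin N → Finset (Fin n) × Bool :=
        fun t => if h : t.val < E.length then E[t.val] else (∅, false)
      have hiff : ∀ x, SatR (List.ofFn σ) x ↔ ∀ e ∈ E, rowParity e.1 x = e.2 := by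
        intro x
        simp only [hSatR]
        constructor
        · intro h e he
          obtain ⟨i, hi, rfl⟩ := List.mem_iff_getElem.1 he
          have ht : (⟨i, by omega⟩ : Fin N).val < E.length := hi
          have := h (σ ⟨i, by omega⟩) (List.mem_ofFn.2 ⟨_, rfl⟩)
          simp only [σ, dif_pos hi] at this
          exact this
        · intro h e' he'
          obtain ⟨t, rfl⟩ := List.mem_ofFn.1 he'
          by_cases ht : t.val < E.length
          · simp only [σ, dif_pos ht]
            exact h _ (List.getElem_mem ht)
          · simp [σ, dif_neg ht, rowParity]
      simp only [hBad, Finset.mem_biUnion, Finset.mem_univ, true_and]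
      refine ⟨σ, !β, ?_⟩
      simp only [hPiece, Finset.mem_filter, Finset.mem_univ, true_and]
      refine ⟨?_, fun x hx => ?_⟩
      · obtain ⟨x, hx⟩ := hsat
        exact ⟨x, (hiff x).2 hx⟩
      · have := hc x ((hiff x).1 hx)
        revert this
        cases g x <;> cases β <;> simp
    refine ⟨g, ?_, hgen⟩
    have h0 := hgen [] (by simp only [List.length_nil]; omega) ⟨fun _ => false, by simp⟩
    obtain ⟨u, -, hu⟩ := h0 true
    obtain ⟨v, -, hv⟩ := h0 false
    exact ⟨u, v, hu, hv⟩

/-- **C1 holds on class L⁺, unconditionally** (both stubs discharged). -/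
theorem strongCompositionLabelAffine_holds : StrongCompositionLabelAffine :=
  strongCompositionLabelAffine_of_genericExist affGenericExist_holds

end Stub2

/-! ## §7  K1b corrected — parity protocols for `KW_g` cost `3n/2`, not `2n` (the `m = 1` case, kernel)

The memo's K1b asked for "full additivity in L⁺", `D^{L⁺}(KW_f ⊛ KW_g) ≥ D(f) + 2n − O(log n)`, on the
grounds that the L⁺-obvious protocol costs `D(f) + 2n`.  THAT TARGET IS FALSE: a HYBRID protocol costs
`D(f) + 3n/2 + O(1)` in L⁺ for EVERY `g` (after `KW_f`: Alice reveals the first half of her row `x`, Bob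
the second half of his row `y`; the public hybrid `z = (x_{≤n/2}, y_{>n/2})` has `g z ∈ {0,1}`; if
`g z = 1 = g x ≠ g y` then `y ≠ z`, so `y` differs from `x` inside the first half and Bob reveals his
first half bit by bit until the difference shows; symmetrically if `g z = 0`).  The right statement is
`3/2`: below, for the pure inner game (`m = 1`: protocols for `KW_g` all of whose messages are parities
of the speaker's input), every affine disperser `g` for dimension `r + 1` forces depth `≥ 3(n − r − 1)/2`
(`parityKW_three_halves`), hence (`§6`) some `g` forces `3n/2 − O(log n)` — tight up to `O(log n)`.

Adversary (three claims, induction on the tree, state = the two answered systems `E_A`, `E_B`):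
(D1) if the COMMON system `E_A ++ E_B` has a solution `z` with `g z = 1`, answering everything "as `z`"
refutes every leaf while `|E_B| ≤ n − r − 2` (Bob's flat through `z` cut by `y_j = z_j` still has
dimension `≥ r + 1`, so a `0`-point `y` with `y_j = z_j = x_j`): `n ≤ depth + |E_B| + r + 1`; (D0)
symmetrically; (U) while the common system has BOTH colours the adversary keeps both (genericity, as long
as `|E_A| + |E_B| ≤ n − r − 2`), and when forced to decide it makes the player who has spoken LESS pay
the D-phase: `3n ≤ 2·depth + 2|E_A| + 2|E_B| + 3(r + 1)`. -/
section ParityKW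
open Classical
variable {n : ℕ}

/-- A node test on vectors is AFFINE over `𝔽₂`: a parity of a fixed coordinate set, possibly negated. -/
def IsAffineV (s : (Fin n → Bool) → Bool) : Prop :=
  ∃ (S : Finset (Fin n)) (c : Bool), ∀ x, s x = Bool.xor (rowParity S x) c

/-- PARITY PROTOCOLS for a KW game on `{0,1}^n`: every message is an affine function of the
speaker's own input (the `m = 1` slice of class L⁺; label tests are constant there). -/
def Parity : Literature.Computability.Complexity.KWTree (Fin n) → Prop
  | .leaf _ => True
  | .alice s P Q => IsAffineV s ∧ Parity P ∧ Parity Q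
  | .bob s P Q => IsAffineV s ∧ Parity P ∧ Parity Q

/-- Systems of parity equations on `{0,1}^n` and their solution predicate. -/
abbrev VSys (n : ℕ) := List (Finset (Fin n) × Bool)

/-- `x` solves every equation of `E`. -/
def VSat (E : VSys n) (x : Fin n → Bool) : Prop := ∀ e ∈ E, rowParity e.1 x = e.2

theorem vsat_append {E F : VSys n} {x : Fin n → Bool} : VSat (E ++ F) x ↔ VSat E x ∧ VSat F x := by
  simp only [VSat, List.mem_append]
  exact ⟨fun h => ⟨fun e he => h e (Or.inl he), fun e he => h e (Or.inr he)⟩,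
    fun h e he => he.elim (h.1 e) (h.2 e)⟩

theorem vsat_singleton {S : Finset (Fin n)} {b : Bool} {x : Fin n → Bool} :
    VSat [(S, b)] x ↔ rowParity S x = b := by
  simp [VSat]

theorem rowParity_single (j : Fin n) (x : Fin n → Bool) : rowParity {j} x = x j := by
  unfold rowParity
  cases hx : x j
  · simp [Finset.filter_singleton, hx]
  · simp [Finset.filter_singleton, hx]

/-- Correctness of `P` for `KW_g` on the rectangle `Sol(E_A) ∩ g⁻¹1 × Sol(E_B) ∩ g⁻¹0`. -/
def CorrectOn (g : (Fin n → Bool) → Bool) (EA EB : VSys n)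
    (P : Literature.Computability.Complexity.KWTree (Fin n)) : Prop :=
  ∀ x y, VSat EA x → g x = true → VSat EB y → g y = false → x (P.run x y) ≠ y (P.run x y)

theorem correctOn_of_solves {g : (Fin n → Bool) → Bool}
    {P : Literature.Computability.Complexity.KWTree (Fin n)} (h : P.Solves g) :
    CorrectOn g [] [] P :=
  fun x y _ hx _ hy => h x y hx hy

/-- The value of an affine test is determined by the parity: `s x = b ↔ rowParity S x = b ⊕ c`. -/
theorem affine_val {s : (Fin n → Bool) → Bool} {S : Finset (Fin n)} {c : Bool}
    (hs : ∀ x, s x = Bool.xor (rowParity S x) c) (x : Fin n → Bool) (b : Bool) :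
    s x = b ↔ rowParity S x = Bool.xor b c := by
  rw [hs x]; cases rowParity S x <;> cases b <;> cases c <;> simp

/-- Descending into the Alice child selected by bit `b` keeps correctness, with Alice's system extended. -/
theorem correctOn_alice {g : (Fin n → Bool) → Bool} {EA EB : VSys n} {s : (Fin n → Bool) → Bool}
    {P Q : Literature.Computability.Complexity.KWTree (Fin n)} {S : Finset (Fin n)} {c : Bool}
    (hs : ∀ x, s x = Bool.xor (rowParity S x) c) (h : CorrectOn g EA EB (.alice s P Q)) (b : Bool) :
    CorrectOn g (EA ++ [(S, Bool.xor b c)]) EB (if b then Q else P) := by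
  intro x y hx hgx hy hgy
  obtain ⟨hxA, hxS⟩ := vsat_append.1 hx
  have hsx : s x = b := (affine_val hs x b).2 (vsat_singleton.1 hxS)
  have := h x y hxA hgx hy hgy
  simp only [Literature.Computability.Complexity.KWTree.run, hsx] at this
  cases b <;> simpa using this

/-- Same for a Bob node. -/
theorem correctOn_bob {g : (Fin n → Bool) → Bool} {EA EB : VSys n} {s : (Fin n → Bool) → Bool}
    {P Q : Literature.Computability.Complexity.KWTree (Fin n)} {S : Finset (Fin n)} {c : Bool}
    (hs : ∀ x, s x = Bool.xor (rowParity S x) c) (h : CorrectOn g EA EB (.bob s P Q)) (b : Bool) :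
    CorrectOn g EA (EB ++ [(S, Bool.xor b c)]) (if b then Q else P) := by
  intro x y hx hgx hy hgy
  obtain ⟨hyB, hyS⟩ := vsat_append.1 hy
  have hsy : s y = b := (affine_val hs y b).2 (vsat_singleton.1 hyS)
  have := h x y hx hgx hyB hgy
  simp only [Literature.Computability.Complexity.KWTree.run, hsy] at this
  cases b <;> simpa using this

/-- The point `z` satisfies the equation recording its own answer. -/
theorem vsat_self {s : (Fin n → Bool) → Bool} {S : Finset (Fin n)} {c : Bool}
    (hs : ∀ x, s x = Bool.xor (rowParity S x) c) (z : Fin n → Bool) :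
    VSat [(S, Bool.xor (s z) c)] z :=
  vsat_singleton.2 ((affine_val hs z (s z)).1 rfl)

theorem depth_child_alice (s : (Fin n → Bool) → Bool)
    (P Q : Literature.Computability.Complexity.KWTree (Fin n)) (b : Bool) :
    (if b then Q else P).depth + 1 ≤ (Literature.Computability.Complexity.KWTree.alice s P Q).depth := by
  cases b <;> simp [Literature.Computability.Complexity.KWTree.depth]

theorem depth_child_bob (s : (Fin n → Bool) → Bool)
    (P Q : Literature.Computability.Complexity.KWTree (Fin n)) (b : Bool) :
    (if b then Q else P).depth + 1 ≤ (Literature.Computability.Complexity.KWTree.bob s P Q).depth := by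
  cases b <;> simp [Literature.Computability.Complexity.KWTree.depth]

theorem parity_child_alice {s : (Fin n → Bool) → Bool}
    {P Q : Literature.Computability.Complexity.KWTree (Fin n)} (h : Parity (.alice s P Q)) (b : Bool) :
    Parity (if b then Q else P) := by
  cases b
  · exact h.2.1
  · exact h.2.2

theorem parity_child_bob {s : (Fin n → Bool) → Bool}
    {P Q : Literature.Computability.Complexity.KWTree (Fin n)} (h : Parity (.bob s P Q)) (b : Bool) :
    Parity (if b then Q else P) := by
  cases b
  · exact h.2.1
  · exact h.2.2

variable {g : (Fin n → Bool) → Bool} {r : ℕ}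

/-- (D1) Committed to colour `1`: Bob must still speak `n − r − 1 − |E_B|` bits. -/
theorem d1_bound (hg : AffGeneric g r) :
    ∀ (P : Literature.Computability.Complexity.KWTree (Fin n)) (EA EB : VSys n),
      Parity P → CorrectOn g EA EB P → (∃ z, VSat (EA ++ EB) z ∧ g z = true) →
      n ≤ P.depth + EB.length + r + 1 := by
  intro P
  induction P with
  | leaf j =>
    intro EA EB _ hcorr ⟨z, hz, hgz⟩
    obtain ⟨hzA, hzB⟩ := vsat_append.1 hz
    by_contra hlt
    push_neg at hlt
    simp only [Literature.Computability.Complexity.KWTree.depth, zero_add] at hlt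
    -- one more equation `y_j = z_j` is still affordable on Bob's side
    have hlen : (EB ++ [({j}, z j)]).length + r + 1 ≤ n := by
      simp only [List.length_append, List.length_singleton]; omega
    obtain ⟨y, hy, hgy⟩ := hg (EB ++ [({j}, z j)]) hlen
      ⟨z, fun e he => by
        rcases List.mem_append.1 he with he | he
        · exact hzB e he
        · simp only [List.mem_singleton] at he; subst he; exact rowParity_single j z⟩ false
    have hyB : VSat EB y := fun e he => hy e (List.mem_append.2 (Or.inl he))
    have hyj : y j = z j := by
      have := hy ({j}, z j) (List.mem_append.2 (Or.inr (List.mem_singleton.2 rfl)))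
      simpa [rowParity_single] using this
    exact hcorr z y hzA hgz hyB hgy (by simpa [Literature.Computability.Complexity.KWTree.run] using hyj.symm)
  | alice s P Q ihP ihQ =>
    intro EA EB hpar hcorr ⟨z, hz, hgz⟩
    obtain ⟨S, c, hs⟩ := hpar.1
    obtain ⟨hzA, hzB⟩ := vsat_append.1 hz
    have hch := correctOn_alice hs hcorr (s z)
    have hz' : VSat ((EA ++ [(S, Bool.xor (s z) c)]) ++ EB) z :=
      vsat_append.2 ⟨vsat_append.2 ⟨hzA, vsat_self hs z⟩, hzB⟩
    have hdep := depth_child_alice s P Q (s z)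
    have key : n ≤ (if s z then Q else P).depth + EB.length + r + 1 := by
      cases hsz : s z
      · simp only [hsz] at hch hz' ⊢
        exact ihP _ _ hpar.2.1 hch ⟨z, hz', hgz⟩
      · simp only [hsz] at hch hz' ⊢
        exact ihQ _ _ hpar.2.2 hch ⟨z, hz', hgz⟩
    omega
  | bob s P Q ihP ihQ =>
    intro EA EB hpar hcorr ⟨z, hz, hgz⟩
    obtain ⟨S, c, hs⟩ := hpar.1
    obtain ⟨hzA, hzB⟩ := vsat_append.1 hz
    have hch := correctOn_bob hs hcorr (s z)
    have hz' : VSat (EA ++ (EB ++ [(S, Bool.xor (s z) c)])) z :=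
      vsat_append.2 ⟨hzA, vsat_append.2 ⟨hzB, vsat_self hs z⟩⟩
    have hdep := depth_child_bob s P Q (s z)
    have hlen : (EB ++ [(S, Bool.xor (s z) c)]).length = EB.length + 1 := by simp
    have key : n ≤ (if s z then Q else P).depth + (EB ++ [(S, Bool.xor (s z) c)]).length + r + 1 := by
      cases hsz : s z
      · simp only [hsz] at hch hz' ⊢
        exact ihP _ _ hpar.2.1 hch ⟨z, hz', hgz⟩
      · simp only [hsz] at hch hz' ⊢
        exact ihQ _ _ hpar.2.2 hch ⟨z, hz', hgz⟩
    rw [hlen] at key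
    omega

/-- (D0) Committed to colour `0`: Alice must still speak `n − r − 1 − |E_A|` bits. -/
theorem d0_bound (hg : AffGeneric g r) :
    ∀ (P : Literature.Computability.Complexity.KWTree (Fin n)) (EA EB : VSys n),
      Parity P → CorrectOn g EA EB P → (∃ z, VSat (EA ++ EB) z ∧ g z = false) →
      n ≤ P.depth + EA.length + r + 1 := by
  intro P
  induction P with
  | leaf j =>
    intro EA EB _ hcorr ⟨z, hz, hgz⟩
    obtain ⟨hzA, hzB⟩ := vsat_append.1 hz
    by_contra hlt
    push_neg at hlt
    simp only [Literature.Computability.Complexity.KWTree.depth, zero_add] at hlt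
    have hlen : (EA ++ [({j}, z j)]).length + r + 1 ≤ n := by
      simp only [List.length_append, List.length_singleton]; omega
    obtain ⟨x, hx, hgx⟩ := hg (EA ++ [({j}, z j)]) hlen
      ⟨z, fun e he => by
        rcases List.mem_append.1 he with he | he
        · exact hzA e he
        · simp only [List.mem_singleton] at he; subst he; exact rowParity_single j z⟩ true
    have hxA : VSat EA x := fun e he => hx e (List.mem_append.2 (Or.inl he))
    have hxj : x j = z j := by
      have := hx ({j}, z j) (List.mem_append.2 (Or.inr (List.mem_singleton.2 rfl)))
      simpa [rowParity_single] using this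
    exact hcorr x z hxA hgx hzB hgz (by simpa [Literature.Computability.Complexity.KWTree.run] using hxj)
  | alice s P Q ihP ihQ =>
    intro EA EB hpar hcorr ⟨z, hz, hgz⟩
    obtain ⟨S, c, hs⟩ := hpar.1
    obtain ⟨hzA, hzB⟩ := vsat_append.1 hz
    have hch := correctOn_alice hs hcorr (s z)
    have hz' : VSat ((EA ++ [(S, Bool.xor (s z) c)]) ++ EB) z :=
      vsat_append.2 ⟨vsat_append.2 ⟨hzA, vsat_self hs z⟩, hzB⟩
    have hdep := depth_child_alice s P Q (s z)
    have hlen : (EA ++ [(S, Bool.xor (s z) c)]).length = EA.length + 1 := by simp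
    have key : n ≤ (if s z then Q else P).depth + (EA ++ [(S, Bool.xor (s z) c)]).length + r + 1 := by
      cases hsz : s z
      · simp only [hsz] at hch hz' ⊢
        exact ihP _ _ hpar.2.1 hch ⟨z, hz', hgz⟩
      · simp only [hsz] at hch hz' ⊢
        exact ihQ _ _ hpar.2.2 hch ⟨z, hz', hgz⟩
    rw [hlen] at key
    omega
  | bob s P Q ihP ihQ =>
    intro EA EB hpar hcorr ⟨z, hz, hgz⟩
    obtain ⟨S, c, hs⟩ := hpar.1
    obtain ⟨hzA, hzB⟩ := vsat_append.1 hz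
    have hch := correctOn_bob hs hcorr (s z)
    have hz' : VSat (EA ++ (EB ++ [(S, Bool.xor (s z) c)])) z :=
      vsat_append.2 ⟨hzA, vsat_append.2 ⟨hzB, vsat_self hs z⟩⟩
    have hdep := depth_child_bob s P Q (s z)
    have key : n ≤ (if s z then Q else P).depth + EA.length + r + 1 := by
      cases hsz : s z
      · simp only [hsz] at hch hz' ⊢
        exact ihP _ _ hpar.2.1 hch ⟨z, hz', hgz⟩
      · simp only [hsz] at hch hz' ⊢
        exact ihQ _ _ hpar.2.2 hch ⟨z, hz', hgz⟩
    omega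

/-- (U) Undecided: the common system has both colours.  The three linear facts say
`remaining depth ≥ (n − r − 1) + max(|E_A|, |E_B|, (n − r − 1)/2) − |E_A| − |E_B|`. -/
theorem u_bound (hg : AffGeneric g r) :
    ∀ (P : Literature.Computability.Complexity.KWTree (Fin n)) (EA EB : VSys n),
      Parity P → CorrectOn g EA EB P →
      (∃ z, VSat (EA ++ EB) z ∧ g z = true) → (∃ z, VSat (EA ++ EB) z ∧ g z = false) →
      n ≤ P.depth + EB.length + r + 1 ∧ n ≤ P.depth + EA.length + r + 1 ∧
        3 * n ≤ 2 * P.depth + 2 * EA.length + 2 * EB.length + 3 * r + 3 := by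
  intro P
  induction P with
  | leaf j =>
    intro EA EB hpar hcorr h1 h0
    have b1 := d1_bound hg _ EA EB hpar hcorr h1
    have b0 := d0_bound hg _ EA EB hpar hcorr h0
    refine ⟨b1, b0, ?_⟩
    obtain ⟨z, hz, hgz⟩ := h1
    obtain ⟨w, hw, hgw⟩ := h0
    obtain ⟨hzA, hzB⟩ := vsat_append.1 hz
    obtain ⟨hwA, hwB⟩ := vsat_append.1 hw
    simp only [Literature.Computability.Complexity.KWTree.depth] at b1 b0 ⊢
    by_contra hlt
    push_neg at hlt
    -- both systems are short: refute the leaf with a fresh `x` through `w_j`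
    have hlen : (EA ++ [({j}, w j)]).length + r + 1 ≤ n := by
      simp only [List.length_append, List.length_singleton]; omega
    obtain ⟨x, hx, hgx⟩ := hg (EA ++ [({j}, w j)]) hlen
      ⟨w, fun e he => by
        rcases List.mem_append.1 he with he | he
        · exact hwA e he
        · simp only [List.mem_singleton] at he; subst he; exact rowParity_single j w⟩ true
    have hxA : VSat EA x := fun e he => hx e (List.mem_append.2 (Or.inl he))
    have hxj : x j = w j := by
      have := hx ({j}, w j) (List.mem_append.2 (Or.inr (List.mem_singleton.2 rfl)))
      simpa [rowParity_single] using this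
    exact hcorr x w hxA hgx hwB hgw (by simpa [Literature.Computability.Complexity.KWTree.run] using hxj)
  | alice s P Q ihP ihQ =>
    intro EA EB hpar hcorr h1 h0
    obtain ⟨S, c, hs⟩ := hpar.1
    obtain ⟨z, hz, hgz⟩ := h1
    obtain ⟨w, hw, hgw⟩ := h0
    obtain ⟨hzA, hzB⟩ := vsat_append.1 hz
    obtain ⟨hwA, hwB⟩ := vsat_append.1 hw
    -- the two available continuations: follow `z` (keeps a 1-point) or follow `w` (keeps a 0-point)
    have hchz := correctOn_alice hs hcorr (s z)
    have hchw := correctOn_alice hs hcorr (s w)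
    have hz' : VSat ((EA ++ [(S, Bool.xor (s z) c)]) ++ EB) z :=
      vsat_append.2 ⟨vsat_append.2 ⟨hzA, vsat_self hs z⟩, hzB⟩
    have hw' : VSat ((EA ++ [(S, Bool.xor (s w) c)]) ++ EB) w :=
      vsat_append.2 ⟨vsat_append.2 ⟨hwA, vsat_self hs w⟩, hwB⟩
    have hdepz := depth_child_alice s P Q (s z)
    have hdepw := depth_child_alice s P Q (s w)
    have hparz := parity_child_alice hpar (s z)
    have hparw := parity_child_alice hpar (s w)
    have hlenz : (EA ++ [(S, Bool.xor (s z) c)]).length = EA.length + 1 := by simp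
    have hlenw : (EA ++ [(S, Bool.xor (s w) c)]).length = EA.length + 1 := by simp
    -- D-bounds along both continuations (always available)
    have bz := d1_bound hg _ _ EB hparz hchz ⟨z, hz', hgz⟩
    have bw := d0_bound hg _ _ EB hparw hchw ⟨w, hw', hgw⟩
    rw [hlenw] at bw
    by_cases hstay : EA.length + EB.length + 1 + r + 1 ≤ n
    · -- stay undecided: follow `z`; genericity supplies a fresh 0-point in the new common system
      have hlen2 : ((EA ++ [(S, Bool.xor (s z) c)]) ++ EB).length + r + 1 ≤ n := by
        simp only [List.length_append, List.length_singleton]; omega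
      obtain ⟨w₂, hw₂, hgw₂⟩ := hg _ hlen2 ⟨z, hz'⟩ false
      have key : n ≤ (if s z then Q else P).depth + EB.length + r + 1 ∧
          n ≤ (if s z then Q else P).depth + (EA ++ [(S, Bool.xor (s z) c)]).length + r + 1 ∧
          3 * n ≤ 2 * (if s z then Q else P).depth + 2 * (EA ++ [(S, Bool.xor (s z) c)]).length
            + 2 * EB.length + 3 * r + 3 := by
        cases hsz : s z
        · simp only [hsz] at hchz hz' hw₂ hparz ⊢
          exact ihP _ EB hparz hchz ⟨z, hz', hgz⟩ ⟨w₂, hw₂, hgw₂⟩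
        · simp only [hsz] at hchz hz' hw₂ hparz ⊢
          exact ihQ _ EB hparz hchz ⟨z, hz', hgz⟩ ⟨w₂, hw₂, hgw₂⟩
      rw [hlenz] at key
      omega
    · -- decide: the player who has spoken less pays
      push_neg at hstay
      refine ⟨?_, ?_, ?_⟩ <;> omega
  | bob s P Q ihP ihQ =>
    intro EA EB hpar hcorr h1 h0
    obtain ⟨S, c, hs⟩ := hpar.1
    obtain ⟨z, hz, hgz⟩ := h1
    obtain ⟨w, hw, hgw⟩ := h0
    obtain ⟨hzA, hzB⟩ := vsat_append.1 hz
    obtain ⟨hwA, hwB⟩ := vsat_append.1 hw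
    have hchz := correctOn_bob hs hcorr (s z)
    have hchw := correctOn_bob hs hcorr (s w)
    have hz' : VSat (EA ++ (EB ++ [(S, Bool.xor (s z) c)])) z :=
      vsat_append.2 ⟨hzA, vsat_append.2 ⟨hzB, vsat_self hs z⟩⟩
    have hw' : VSat (EA ++ (EB ++ [(S, Bool.xor (s w) c)])) w :=
      vsat_append.2 ⟨hwA, vsat_append.2 ⟨hwB, vsat_self hs w⟩⟩
    have hdepz := depth_child_bob s P Q (s z)
    have hdepw := depth_child_bob s P Q (s w)
    have hparz := parity_child_bob hpar (s z)
    have hparw := parity_child_bob hpar (s w)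
    have hlenz : (EB ++ [(S, Bool.xor (s z) c)]).length = EB.length + 1 := by simp
    have hlenw : (EB ++ [(S, Bool.xor (s w) c)]).length = EB.length + 1 := by simp
    have bz := d1_bound hg _ EA _ hparz hchz ⟨z, hz', hgz⟩
    have bw := d0_bound hg _ EA _ hparw hchw ⟨w, hw', hgw⟩
    rw [hlenz] at bz
    by_cases hstay : EA.length + EB.length + 1 + r + 1 ≤ n
    · have hlen2 : (EA ++ (EB ++ [(S, Bool.xor (s z) c)])).length + r + 1 ≤ n := by
        simp only [List.length_append, List.length_singleton]; omega
      obtain ⟨w₂, hw₂, hgw₂⟩ := hg _ hlen2 ⟨z, hz'⟩ false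
      have key : n ≤ (if s z then Q else P).depth + (EB ++ [(S, Bool.xor (s z) c)]).length + r + 1 ∧
          n ≤ (if s z then Q else P).depth + EA.length + r + 1 ∧
          3 * n ≤ 2 * (if s z then Q else P).depth + 2 * EA.length
            + 2 * (EB ++ [(S, Bool.xor (s z) c)]).length + 3 * r + 3 := by
        cases hsz : s z
        · simp only [hsz] at hchz hz' hw₂ hparz ⊢
          exact ihP EA _ hparz hchz ⟨z, hz', hgz⟩ ⟨w₂, hw₂, hgw₂⟩
        · simp only [hsz] at hchz hz' hw₂ hparz ⊢
          exact ihQ EA _ hparz hchz ⟨z, hz', hgz⟩ ⟨w₂, hw₂, hgw₂⟩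
      rw [hlenz] at key
      omega
    · push_neg at hstay
      refine ⟨?_, ?_, ?_⟩ <;> omega

/-- **Parity protocols for `KW_g` need `3n/2 − O(r)` bits** when `g` is an affine disperser for
dimension `r + 1` (both colours on every flat of dimension `≥ r + 1`). -/
theorem parityKW_three_halves (hg : AffGeneric g r)
    (P : Literature.Computability.Complexity.KWTree (Fin n)) (hP : Parity P) (hsol : P.Solves g) :
    3 * n ≤ 2 * P.depth + 3 * (r + 1) := by
  by_cases hrn : r + 1 ≤ n
  · have h := fun β => hg [] (by simp only [List.length_nil]; omega) ⟨fun _ => false, by simp⟩ β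
    obtain ⟨z, -, hz⟩ := h true
    obtain ⟨w, -, hw⟩ := h false
    have := (u_bound hg P [] [] hP (correctOn_of_solves hsol)
      ⟨z, by simp [VSat], hz⟩ ⟨w, by simp [VSat], hw⟩).2.2
    simp only [List.length_nil] at this
    omega
  · omega

/-- Hence (with §6): for every `n ≥ 1` some `g : {0,1}^n → {0,1}` forces every parity protocol for
`KW_g` to depth `≥ 3n/2 − O(log₂ n)` (`c = 3c₀ + 3 = 9` with §6's `c₀ = 2`); the hybrid protocol shows
`3n/2 + O(1)` suffices for every `g`, so the constant `3/2` is the truth for parity protocols. -/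
theorem parityKW_three_halves_exists : ∃ c : ℕ, ∀ n : ℕ, 1 ≤ n → ∃ g : (Fin n → Bool) → Bool,
    (∃ u v, g u = true ∧ g v = false) ∧
    ∀ P : Literature.Computability.Complexity.KWTree (Fin n), Parity P → P.Solves g →
      3 * n ≤ 2 * P.depth + c * (Nat.log 2 n + 1) := by
  obtain ⟨c₀, hc₀⟩ := affGenericExist_holds
  refine ⟨3 * c₀ + 3, fun n hn => ?_⟩
  obtain ⟨g, hg01, hgen⟩ := hc₀ n hn
  refine ⟨g, hg01, fun P hP hsol => ?_⟩
  have := parityKW_three_halves hgen P hP hsol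
  nlinarith [Nat.zero_le (Nat.log 2 n)]

/-! ### The matching upper bound: the HYBRID protocol (`3n/2 + 1` bits, every `g`) -/

/-- Override `ρ` by `x` on the coordinates listed in `L`. -/
def ovr (L : List (Fin n)) (x ρ : Fin n → Bool) : Fin n → Bool := fun j => if j ∈ L then x j else ρ j

/-- Alice reveals her coordinates listed in `L` one by one (recorded into `ρ`), then play continues
with `k ρ`. -/
def revealA : List (Fin n) → (Fin n → Bool) →
    ((Fin n → Bool) → Literature.Computability.Complexity.KWTree (Fin n)) →
    Literature.Computability.Complexity.KWTree (Fin n)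
  | [], ρ, k => k ρ
  | i :: L, ρ, k => .alice (fun x => x i) (revealA L (Function.update ρ i false) k)
      (revealA L (Function.update ρ i true) k)

/-- Bob reveals his coordinates listed in `L`. -/
def revealB : List (Fin n) → (Fin n → Bool) →
    ((Fin n → Bool) → Literature.Computability.Complexity.KWTree (Fin n)) →
    Literature.Computability.Complexity.KWTree (Fin n)
  | [], ρ, k => k ρ
  | i :: L, ρ, k => .bob (fun y => y i) (revealB L (Function.update ρ i false) k)
      (revealB L (Function.update ρ i true) k)

/-- Bob reveals coordinates of `L` until one differs from the public values `ρ`; output it. -/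
def searchB (ρ : Fin n → Bool) (d : Fin n) : List (Fin n) → Literature.Computability.Complexity.KWTree (Fin n)
  | [] => .leaf d
  | i :: L => .bob (fun y => y i) (bif ρ i then .leaf i else searchB ρ d L)
      (bif ρ i then searchB ρ d L else .leaf i)

/-- Alice reveals coordinates of `L` until one differs from the public values `ρ`; output it. -/
def searchA (ρ : Fin n → Bool) (d : Fin n) : List (Fin n) → Literature.Computability.Complexity.KWTree (Fin n)
  | [] => .leaf d
  | i :: L => .alice (fun x => x i) (bif ρ i then .leaf i else searchA ρ d L)
      (bif ρ i then searchA ρ d L else .leaf i)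

theorem isAffineV_coord (i : Fin n) : IsAffineV (fun x : Fin n → Bool => x i) :=
  ⟨{i}, false, fun x => by simp only [rowParity_single, Bool.xor_false]⟩

theorem ovr_nil (x ρ : Fin n → Bool) : ovr [] x ρ = ρ := by
  funext j; simp [ovr]

theorem parity_revealA {k : (Fin n → Bool) → Literature.Computability.Complexity.KWTree (Fin n)}
    (hk : ∀ ρ, Parity (k ρ)) : ∀ (L : List (Fin n)) (ρ), Parity (revealA L ρ k)
  | [], ρ => hk ρ
  | i :: L, ρ => ⟨isAffineV_coord i, parity_revealA hk L _, parity_revealA hk L _⟩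

theorem parity_revealB {k : (Fin n → Bool) → Literature.Computability.Complexity.KWTree (Fin n)}
    (hk : ∀ ρ, Parity (k ρ)) : ∀ (L : List (Fin n)) (ρ), Parity (revealB L ρ k)
  | [], ρ => hk ρ
  | i :: L, ρ => ⟨isAffineV_coord i, parity_revealB hk L _, parity_revealB hk L _⟩

theorem parity_searchB (ρ : Fin n → Bool) (d : Fin n) : ∀ L, Parity (searchB ρ d L)
  | [] => trivial
  | i :: L => by
    refine ⟨isAffineV_coord i, ?_, ?_⟩ <;> cases ρ i
    · exact parity_searchB ρ d L
    · trivial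
    · trivial
    · exact parity_searchB ρ d L

theorem parity_searchA (ρ : Fin n → Bool) (d : Fin n) : ∀ L, Parity (searchA ρ d L)
  | [] => trivial
  | i :: L => by
    refine ⟨isAffineV_coord i, ?_, ?_⟩ <;> cases ρ i
    · exact parity_searchA ρ d L
    · trivial
    · trivial
    · exact parity_searchA ρ d L

theorem depth_revealA {k : (Fin n → Bool) → Literature.Computability.Complexity.KWTree (Fin n)} {D : ℕ}
    (hk : ∀ ρ, (k ρ).depth ≤ D) : ∀ (L : List (Fin n)) (ρ), (revealA L ρ k).depth ≤ L.length + D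
  | [], ρ => by simpa [revealA] using hk ρ
  | i :: L, ρ => by
    have h1 := depth_revealA hk L (Function.update ρ i false)
    have h2 := depth_revealA hk L (Function.update ρ i true)
    simp only [revealA, Literature.Computability.Complexity.KWTree.depth, List.length_cons]
    omega

theorem depth_revealB {k : (Fin n → Bool) → Literature.Computability.Complexity.KWTree (Fin n)} {D : ℕ}
    (hk : ∀ ρ, (k ρ).depth ≤ D) : ∀ (L : List (Fin n)) (ρ), (revealB L ρ k).depth ≤ L.length + D
  | [], ρ => by simpa [revealB] using hk ρ
  | i :: L, ρ => by
    have h1 := depth_revealB hk L (Function.update ρ i false)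
    have h2 := depth_revealB hk L (Function.update ρ i true)
    simp only [revealB, Literature.Computability.Complexity.KWTree.depth, List.length_cons]
    omega

theorem depth_searchB (ρ : Fin n → Bool) (d : Fin n) : ∀ L, (searchB ρ d L).depth ≤ L.length
  | [] => by simp [searchB, Literature.Computability.Complexity.KWTree.depth]
  | i :: L => by
    have h := depth_searchB ρ d L
    simp only [searchB, Literature.Computability.Complexity.KWTree.depth, List.length_cons]
    cases ρ i <;> simp [Literature.Computability.Complexity.KWTree.depth] <;> omega

theorem depth_searchA (ρ : Fin n → Bool) (d : Fin n) : ∀ L, (searchA ρ d L).depth ≤ L.length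
  | [] => by simp [searchA, Literature.Computability.Complexity.KWTree.depth]
  | i :: L => by
    have h := depth_searchA ρ d L
    simp only [searchA, Literature.Computability.Complexity.KWTree.depth, List.length_cons]
    cases ρ i <;> simp [Literature.Computability.Complexity.KWTree.depth] <;> omega

theorem ovr_cons (i : Fin n) (L : List (Fin n)) (x ρ : Fin n → Bool) :
    ovr L x (Function.update ρ i (x i)) = ovr (i :: L) x ρ := by
  funext j
  by_cases hj : j ∈ L
  · simp [ovr, hj]
  · by_cases hji : j = i
    · subst hji; simp [ovr, hj]
    · simp [ovr, hj, hji, Function.update_of_ne hji]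

theorem run_revealA {k : (Fin n → Bool) → Literature.Computability.Complexity.KWTree (Fin n)}
    (x y : Fin n → Bool) : ∀ (L : List (Fin n)) (ρ),
    (revealA L ρ k).run x y = (k (ovr L x ρ)).run x y
  | [], ρ => by simp [revealA, ovr_nil]
  | i :: L, ρ => by
    rw [← ovr_cons]
    simp only [revealA, Literature.Computability.Complexity.KWTree.run]
    cases hx : x i
    · simpa [hx] using run_revealA x y L (Function.update ρ i false)
    · simpa [hx] using run_revealA x y L (Function.update ρ i true)

theorem run_revealB {k : (Fin n → Bool) → Literature.Computability.Complexity.KWTree (Fin n)}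
    (x y : Fin n → Bool) : ∀ (L : List (Fin n)) (ρ),
    (revealB L ρ k).run x y = (k (ovr L y ρ)).run x y
  | [], ρ => by simp [revealB, ovr_nil]
  | i :: L, ρ => by
    rw [← ovr_cons]
    simp only [revealB, Literature.Computability.Complexity.KWTree.run]
    cases hy : y i
    · simpa [hy] using run_revealB x y L (Function.update ρ i false)
    · simpa [hy] using run_revealB x y L (Function.update ρ i true)

theorem searchB_correct (ρ : Fin n → Bool) (d : Fin n) (x y : Fin n → Bool) :
    ∀ L : List (Fin n), (∀ i ∈ L, x i = ρ i) → (∃ i ∈ L, y i ≠ x i) →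
      x ((searchB ρ d L).run x y) ≠ y ((searchB ρ d L).run x y)
  | [], _, ⟨i, hi, _⟩ => by simp at hi
  | i :: L, hagree, hdiff => by
    have hxi : x i = ρ i := hagree i (by simp)
    have hL : ∀ i' ∈ L, x i' = ρ i' := fun i' hi' => hagree i' (by simp [hi'])
    simp only [searchB, Literature.Computability.Complexity.KWTree.run]
    cases hy : y i <;> cases hρ : ρ i <;>
      simp only [hρ, cond_true, cond_false, Literature.Computability.Complexity.KWTree.run,
        Bool.false_eq_true, ↓reduceIte, if_true]
    · -- y i = false, ρ i = false: continue
      refine searchB_correct ρ d x y L hL ?_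
      obtain ⟨i', hi', hne⟩ := hdiff
      rcases List.mem_cons.1 hi' with rfl | hi'
      · exact absurd (by rw [hy, hxi, hρ]) hne
      · exact ⟨i', hi', hne⟩
    · -- y i = false, ρ i = true: leaf i
      rw [hxi, hρ, hy]; decide
    · rw [hxi, hρ, hy]; decide
    · refine searchB_correct ρ d x y L hL ?_
      obtain ⟨i', hi', hne⟩ := hdiff
      rcases List.mem_cons.1 hi' with rfl | hi'
      · exact absurd (by rw [hy, hxi, hρ]) hne
      · exact ⟨i', hi', hne⟩

theorem searchA_correct (ρ : Fin n → Bool) (d : Fin n) (x y : Fin n → Bool) :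
    ∀ L : List (Fin n), (∀ i ∈ L, y i = ρ i) → (∃ i ∈ L, x i ≠ y i) →
      x ((searchA ρ d L).run x y) ≠ y ((searchA ρ d L).run x y)
  | [], _, ⟨i, hi, _⟩ => by simp at hi
  | i :: L, hagree, hdiff => by
    have hyi : y i = ρ i := hagree i (by simp)
    have hL : ∀ i' ∈ L, y i' = ρ i' := fun i' hi' => hagree i' (by simp [hi'])
    simp only [searchA, Literature.Computability.Complexity.KWTree.run]
    cases hx : x i <;> cases hρ : ρ i <;>
      simp only [hρ, cond_true, cond_false, Literature.Computability.Complexity.KWTree.run,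
        Bool.false_eq_true, ↓reduceIte, if_true]
    · refine searchA_correct ρ d x y L hL ?_
      obtain ⟨i', hi', hne⟩ := hdiff
      rcases List.mem_cons.1 hi' with rfl | hi'
      · exact absurd (by rw [hx, hyi, hρ]) hne
      · exact ⟨i', hi', hne⟩
    · rw [hyi, hρ, hx]; decide
    · rw [hyi, hρ, hx]; decide
    · refine searchA_correct ρ d x y L hL ?_
      obtain ⟨i', hi', hne⟩ := hdiff
      rcases List.mem_cons.1 hi' with rfl | hi'
      · exact absurd (by rw [hx, hyi, hρ]) hne
      · exact ⟨i', hi', hne⟩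

/-- The HYBRID protocol for `KW_g`: Alice reveals the first `⌈n/2⌉` coordinates, Bob the rest; the
public hybrid `z` tells, via `g z`, which player's hidden part contains a difference; that player
reveals it until the difference shows. -/
def hybrid (hn : 1 ≤ n) (g : (Fin n → Bool) → Bool) : Literature.Computability.Complexity.KWTree (Fin n) :=
  let L₁ := (List.finRange n).take ((n + 1) / 2)
  let L₂ := (List.finRange n).drop ((n + 1) / 2)
  revealA L₁ (fun _ => false) fun ρ₁ => revealB L₂ ρ₁ fun z =>
    bif g z then searchB z ⟨0, hn⟩ L₁ else searchA z ⟨0, hn⟩ L₂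

/-- **Upper bound.**  For EVERY `g` the hybrid protocol is a parity protocol solving `KW_g` in
`≤ n + ⌈n/2⌉` rounds: `2·depth ≤ 3n + 1`. -/
theorem parityKW_upper (hn : 1 ≤ n) (g : (Fin n → Bool) → Bool) :
    Parity (hybrid hn g) ∧ (hybrid hn g).Solves g ∧ 2 * (hybrid hn g).depth ≤ 3 * n + 1 := by
  set h := (n + 1) / 2 with hh
  set L₁ := (List.finRange n).take h with hL₁
  set L₂ := (List.finRange n).drop h with hL₂
  have hlen₁ : L₁.length = h := by
    rw [hL₁, List.length_take, List.length_finRange]; omega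
  have hlen₂ : L₂.length = n - h := by rw [hL₂, List.length_drop, List.length_finRange]
  have hcover : ∀ j : Fin n, j ∈ L₁ ∨ j ∈ L₂ := fun j =>
    List.mem_append.1 (by rw [hL₁, hL₂, List.take_append_drop]; exact List.mem_finRange j)
  have hdisj : ∀ j : Fin n, j ∈ L₁ → j ∉ L₂ := by
    have := (List.nodup_finRange n)
    rw [← List.take_append_drop h (List.finRange n), List.nodup_append] at this
    exact fun j hj hj' => this.2.2 j hj j hj' rfl
  refine ⟨?_, ?_, ?_⟩
  · -- parity
    refine parity_revealA (fun ρ₁ => parity_revealB (fun z => ?_) _ _) _ _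
    cases g z
    · exact parity_searchA _ _ _
    · exact parity_searchB _ _ _
  · -- correctness
    intro x y hx hy
    show x ((hybrid hn g).run x y) ≠ y ((hybrid hn g).run x y)
    have hrun : (hybrid hn g).run x y =
        (bif g (ovr L₂ y (ovr L₁ x fun _ => false)) then searchB (ovr L₂ y (ovr L₁ x fun _ => false)) ⟨0, hn⟩ L₁
          else searchA (ovr L₂ y (ovr L₁ x fun _ => false)) ⟨0, hn⟩ L₂).run x y := by
      simp only [hybrid]
      rw [run_revealA, run_revealB]
    set z := ovr L₂ y (ovr L₁ x fun _ => false) with hz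
    have hz₁ : ∀ j ∈ L₁, z j = x j := fun j hj => by
      simp [hz, ovr, hj, hdisj j hj]
    have hz₂ : ∀ j ∈ L₂, z j = y j := fun j hj => by simp [hz, ovr, hj]
    rw [hrun]
    cases hgz : g z
    · -- `z` has colour 0 like `y`, so it differs from `x`, inside `L₂`
      simp only [cond_false]
      have hne : z ≠ x := fun h => by rw [h, hx] at hgz; exact Bool.noConfusion hgz
      obtain ⟨j, hj⟩ : ∃ j, z j ≠ x j := by
        by_contra hc; push_neg at hc; exact hne (funext hc)
      have hj₂ : j ∈ L₂ := by
        rcases hcover j with h1 | h2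
        · exact absurd (hz₁ j h1) hj
        · exact h2
      exact searchA_correct z ⟨0, hn⟩ x y L₂ (fun i hi => (hz₂ i hi).symm)
        ⟨j, hj₂, fun h => hj (by rw [hz₂ j hj₂, h])⟩
    · simp only [cond_true]
      have hne : z ≠ y := fun h => by rw [h, hy] at hgz; exact Bool.noConfusion hgz
      obtain ⟨j, hj⟩ : ∃ j, z j ≠ y j := by
        by_contra hc; push_neg at hc; exact hne (funext hc)
      have hj₁ : j ∈ L₁ := by
        rcases hcover j with h1 | h2
        · exact h1
        · exact absurd (hz₂ j h2) hj
      exact searchB_correct z ⟨0, hn⟩ x y L₁ (fun i hi => (hz₁ i hi).symm)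
        ⟨j, hj₁, fun h => hj (by rw [hz₁ j hj₁, h])⟩
  · -- depth
    have hk : ∀ ρ₁, (revealB L₂ ρ₁ fun z =>
        bif g z then searchB z ⟨0, hn⟩ L₁ else searchA z ⟨0, hn⟩ L₂).depth ≤ L₂.length + h := by
      intro ρ₁
      refine depth_revealB (fun z => ?_) _ _
      cases g z
      · simpa using (depth_searchA z ⟨0, hn⟩ L₂).trans (by omega)
      · simpa using (depth_searchB z ⟨0, hn⟩ L₁).trans (by omega)
    have hd : (hybrid hn g).depth ≤ L₁.length + (L₂.length + h) :=
      depth_revealA hk L₁ (fun _ => false)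
    rw [hlen₁, hlen₂] at hd
    omega

end ParityKW

end Summit.PneNP.PneNP.Cruxes.StrongComposition.P4g18
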